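import Literature.Analysis.FluidPDE.PassiveScalarEnergyMollified
import Literature.Analysis.FluidPDE.PassiveScalarRenormalizedSlice
import Literature.Analysis.FluidPDE.PassiveScalarEnergyProofs
import Literature.Analysis.Calculus.RenormalizedPrimitive
import Mathlib.Analysis.Calculus.ContDiff.Polynomial
import Mathlib.Topology.ContinuousMap.Weierstrass
import HarnessLib

/-!
# The DiPerna–Lions renormalisation theorem for the transport equation with Lipschitz drift
# (`∂ₜθ + u·∇θ = 0` on `T^d × [0,T)`: every weak solution renormalises)

Analysis/FluidPDE proof file (everything proved; no definitions, no named facts).  For a drift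
`u ∈ L¹(0,T; W^{1,∞}(T^d))` — `u(t)` `L(t)`-Lipschitz for a.e. `t`, `∫₀ᵀ L < ∞` — weakly divergence free
at a.e. time, and a weak solution `θ ∈ L^∞(0,T; L²)` of the transport equation in the tree's class
`Torus.IsWeakScalarTransportOn T 0 u θ₀ θ`:
* `IsWeakScalarTransportOn.comp_of_lipschitz_of_contDiff` — for `θ₀ ∈ L²` and every `β ∈ C^∞(ℝ)`
  which is globally Lipschitz, `β ∘ θ` is a weak solution with datum `β ∘ θ₀`;
* `IsWeakScalarTransportOn.comp_of_lipschitz_of_abs_le` — for a BOUNDED weak solution with bounded datum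
  the same holds for every continuous `β` (in particular every `β ∈ C¹(ℝ)`, the form of
  Bagnara–Boutros–De Lellis–Mayboroda 2026, Def. 2.1)
— the DiPerna–Lions renormalisation property
[cite: DiPernaLions1989, §II.3 Thm. II.3 (renormalised solutions), Cor. II.1; §II.1 Lemma II.1 (commutators)],
here in the `L(t)`-Lipschitz/`L²` setting of the tree's uniqueness theorem
`IsWeakScalarTransportOn.unique_of_lipschitz_holds` (Ambrosio–Crippa 2014, Thm. 4.4 / proof of Thm. 4.6).

Proof (DiPerna–Lions, op. cit. §II.3, followed step by step): mollify in space, `A_ε = θ ⋆ k_ε`;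
pointwise in `x`, `A_ε(t,x) = (θ₀ ⋆ k_ε)(x) + ∫₀ᵗ G_ε(s,x) ds` (`PassiveScalarEnergyMollified`), so
`β(A_ε(·,x)) = β(θ₀ ⋆ k_ε)(x) + ∫₀ᵗ β'(A_ε)G_ε` (`Calculus/RenormalizedPrimitive`) and, against a
space–time test `ψ`, the product formula for primitives (`DuBoisReymondAE`) integrates by parts in time
(§1); Fubini (§2) and the flux algebra `G_ε = r_ε - ⟪u, ∇A_ε⟫` with weak incompressibility tested
against `β(A_ε)ψ` (§3) give `∫∫ β(A_ε)(∂ₜψ + u·∇ψ) + ∫ β(θ₀⋆k_ε)ψ(0) = -∫∫ β'(A_ε) r_ε ψ`; the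
commutator lemma for Lipschitz drifts (`Torus.eLpNorm_comm_le`, `Torus.tendsto_eLpNorm_comm`) and
dominated convergence kill the right side while `A_ε → θ` in `L²` slice-wise (§4); continuous `β` for
bounded solutions by uniform approximation on the essential range by smooth Lipschitz functions
(Weierstrass polynomial times a smooth cut-off, §5).

Consumer: the renormalisation PRODUCER for the barrier `Barriers/AnomalousDissipation/RenormalisationNoAnomaly`
(smooth drifts on a closed slab renormalise) and the kernel refutation of the vendored fact
`BagnaraEtAl2026_thm31` (`Barriers/AnomalousDissipation/RenormalisationNoAnomalyRefutation`).

## Mathlib / tree search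
Mathlib: no transport-equation / renormalised-solution theory (searched `renormali`, `DiPerna`,
`transport` in `Analysis/PDE`: none); used `tendsto_integral_of_dominated_convergence`,
`tendsto_lintegral_of_dominated_convergence'`, `ENNReal.lintegral_mul_le_Lp_mul_Lq`,
`exists_polynomial_near_of_continuousOn`, `ContDiffBump`, `ContDiff.lipschitzWith_of_hasCompactSupport`.
Tree: `PassiveScalarProofs` (commutator lemma, `unique_of_lipschitz_holds` architecture),
`PassiveScalarEnergyMollified`, `PassiveScalarRenormalizedSlice`, `Calculus/RenormalizedPrimitive`,
`FunctionSpaces/DuBoisReymondAE`, `TorusConvolution.tendsto_eLpNorm_convolution_sub_self`.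

## References
* R. J. DiPerna, P.-L. Lions, Invent. Math. 98 (1989), §II.1 Lemma II.1, §II.3 Thm. II.3, Cor. II.1. [`DiPernaLions1989`]
* L. Ambrosio, G. Crippa, Proc. Roy. Soc. Edinburgh 144A (2014), §4, Thms. 4.4, 4.6. [`AmbrosioCrippa2014`]
* M. Bagnara, D. W. Boutros, C. De Lellis, S. Mayboroda, arXiv:2603.11466v3 (2026), Def. 2.1 p. 5. [`BagnaraEtAl2026`]
-/


noncomputable section

open MeasureTheory TopologicalSpace Set Function Filter Topology Metric ContinuousLinearMap UnitAddTorus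
open scoped ENNReal NNReal Convolution ContDiff InnerProductSpace

namespace Literature.Analysis.FluidPDE

namespace Torus

variable {d : Type*} [Fintype d]

namespace IsWeakScalarTransportOn

variable {T : ℝ} {u : ℝ → UnitAddTorus d → EuclideanSpace ℝ d} {θ₀ : UnitAddTorus d → ℝ}
  {θ : ℝ → UnitAddTorus d → ℝ}

/-! ## §1 The renormalised mollified equation tested in time, at a point -/

/-- The time slice `τ ↦ ψ τ x` of a space–time test field is differentiable with derivative
`timeDeriv ψ τ x`. [folklore] -/
private theorem hasDerivAt_test_slice {ψ : ℝ → UnitAddTorus d → ℝ} (hψ : FunctionSpaces.Torus.IsSpaceTimeTest T ψ)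
    (x : UnitAddTorus d) (τ : ℝ) :
    HasDerivAt (fun s => ψ s x) (FunctionSpaces.Torus.timeDeriv ψ τ x) τ := by
  obtain ⟨w, hw⟩ := FunctionSpaces.Torus.proj_surjective x
  have hd : Differentiable ℝ (fun s : ℝ => FunctionSpaces.Torus.stLift ψ (s, w)) :=
    (hψ.1.differentiable (by simp)).comp (differentiable_id.prodMk (differentiable_const w))
  have e : (fun s : ℝ => ψ s x) = fun s => FunctionSpaces.Torus.stLift ψ (s, w) := by
    funext s; simp [FunctionSpaces.Torus.stLift, hw]
  rw [FunctionSpaces.Torus.timeDeriv, e]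
  exact (hd τ).hasDerivAt

/-- FTC for the time slice of a test field: `ψ(t,x) = ψ(0,x) + ∫_{(0,t]} ∂ₜψ(s,x) ds`, `t ≥ 0`. [folklore] -/
private theorem test_eq_add_setIntegral_timeDeriv {ψ : ℝ → UnitAddTorus d → ℝ}
    (hψ : FunctionSpaces.Torus.IsSpaceTimeTest T ψ) (x : UnitAddTorus d) {t : ℝ} (ht : 0 ≤ t) :
    ψ t x = ψ 0 x + ∫ s in Ioc 0 t, FunctionSpaces.Torus.timeDeriv ψ s x := by
  have hcont : Continuous fun s => FunctionSpaces.Torus.timeDeriv ψ s x :=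
    hψ.continuous_uncurry_timeDeriv.comp (continuous_id.prodMk continuous_const)
  rw [← intervalIntegral.integral_of_le ht,
    intervalIntegral.integral_eq_sub_of_hasDerivAt (fun s _ => hasDerivAt_test_slice hψ x s)
      (hcont.intervalIntegrable _ _)]
  ring

/-- **The renormalised mollified equation, tested in time, at a point** (DiPerna–Lions 1989, §II.3, the
equation for `β(u_ε)`, here in primitive form).  With `c = (θ₀ ⋆ k)(x)`, the flux `g(s) = G(s,x)`, the
primitive `P(s) = c + ∫_{(0,s]} g` and a test field `ψ` on `[0,T)`:
`∫_{(0,T)} ( β'(P(s)) g(s) ψ(s,x) + β(P(s)) ∂ₜψ(s,x) ) ds = -β(c) ψ(0,x)`. [cite: DiPernaLions1989, §II.3 Thm. II.3 (proof)] -/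
theorem setIntegral_renorm_primitive_test (h : IsWeakScalarTransportOn T 0 u θ₀ θ) (hT : 0 < T)
    {k : UnitAddTorus d → ℝ} (hk : FunctionSpaces.Torus.IsSmooth k)
    {β : ℝ → ℝ} (hβ : ContDiff ℝ 1 β) {K : ℝ≥0} (hβK : LipschitzWith K β)
    {ψ : ℝ → UnitAddTorus d → ℝ} (hψ : FunctionSpaces.Torus.IsSpaceTimeTest T ψ) (x : UnitAddTorus d) :
    ∫ s in Ioo 0 T,
        (deriv β ((∫ y, θ₀ y * k (x - y)) + ∫ r in Ioc 0 s, ∫ y, θ r y *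
            (-⟪u r y, FunctionSpaces.Torus.gradient k (x - y)⟫_ℝ + 0 * FunctionSpaces.Torus.laplacian k (x - y))) *
          (∫ y, θ s y * (-⟪u s y, FunctionSpaces.Torus.gradient k (x - y)⟫_ℝ + 0 * FunctionSpaces.Torus.laplacian k (x - y))) *
          ψ s x +
        β ((∫ y, θ₀ y * k (x - y)) + ∫ r in Ioc 0 s, ∫ y, θ r y *
            (-⟪u r y, FunctionSpaces.Torus.gradient k (x - y)⟫_ℝ + 0 * FunctionSpaces.Torus.laplacian k (x - y))) *
          FunctionSpaces.Torus.timeDeriv ψ s x)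
      = -(β (∫ y, θ₀ y * k (x - y)) * ψ 0 x) := by
  set c : ℝ := ∫ y, θ₀ y * k (x - y) with hc
  set g : ℝ → ℝ := fun s => ∫ y, θ s y *
    (-⟪u s y, FunctionSpaces.Torus.gradient k (x - y)⟫_ℝ + 0 * FunctionSpaces.Torus.laplacian k (x - y)) with hg
  have hgI : IntegrableOn g (Ioo 0 T) volume := (h.integrable_mul_flux hk x).integral_prod_left
  have hgIc : IntegrableOn g (Ioc 0 T) volume := (integrableOn_Ioc_iff_integrableOn_Ioo (f := g)).2 hgI
  set P : ℝ → ℝ := fun s => c + ∫ r in Ioc 0 s, g r with hP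
  set φ : ℝ → ℝ := fun s => deriv β (P s) * g s with hφ
  set F : ℝ → ℝ := fun s => β (P s) with hF
  set γ : ℝ → ℝ := fun s => FunctionSpaces.Torus.timeDeriv ψ s x with hγ
  -- `β'` is bounded by the Lipschitz constant
  have hβ' : ∀ z, ‖deriv β z‖ ≤ K := fun z => norm_deriv_le_of_lipschitz hβK
  -- the primitive is continuous on `[0,T]`
  have hPc : ContinuousOn P (Icc 0 T) := by
    have h1 : ContinuousOn (fun s => ∫ r in (0:ℝ)..s, g r) (Icc 0 T) := by
      have := intervalIntegral.continuousOn_primitive_interval' (μ := volume) (f := g) (b₁ := 0) (b₂ := T)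
        ((intervalIntegrable_iff_integrableOn_Ioc_of_le hT.le).2 hgIc) (by rw [uIcc_of_le hT.le]; exact ⟨le_rfl, hT.le⟩)
      rwa [uIcc_of_le hT.le] at this
    refine ((continuousOn_const (c := c)).add h1).congr fun s hs => ?_
    simp only [hP, intervalIntegral.integral_of_le hs.1, Pi.add_apply]
  have hPm : AEStronglyMeasurable P (volume.restrict (Ioo 0 T)) :=
    (hPc.mono Ioo_subset_Icc_self).aestronglyMeasurable measurableSet_Ioo
  -- `φ` is integrable on `(0,T)`
  have hφI : IntegrableOn φ (Ioo 0 T) volume := by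
    refine Integrable.bdd_mul (c := K) hgI (((hβ.continuous_deriv le_rfl).comp_aestronglyMeasurable hPm)) ?_
    exact Eventually.of_forall fun s => hβ' _
  -- `γ` is continuous, hence integrable on `(0,T)`
  have hγc : Continuous γ := hψ.continuous_uncurry_timeDeriv.comp (continuous_id.prodMk continuous_const)
  have hγI : IntegrableOn γ (Ioo 0 T) volume := hγc.integrableOn_Icc.mono_set Ioo_subset_Icc_self
  -- the two primitives
  have hFeq : ∀ t ∈ Ioc 0 T, F t = β c + ∫ s in Ioc 0 t, φ s := by
    intro t ht
    simp only [hF, hP, hφ]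
    exact Calculus.comp_const_add_setIntegral_eq ht.1.le (hgIc.mono_set (Ioc_subset_Ioc_right ht.2)) hβ hβK
  have hGeq : ∀ t ∈ Ioc 0 T, ψ t x = ψ 0 x + ∫ s in Ioc 0 t, γ s := fun t ht =>
    test_eq_add_setIntegral_timeDeriv hψ x ht.1.le
  -- the product formula at `t = T`, where `ψ(T, x) = 0`
  obtain ⟨-, hprod⟩ := FunctionSpaces.mul_eq_add_setIntegral_of_eq_add_setIntegral hφI hγI hFeq hGeq
    (t := T) ⟨hT, le_rfl⟩
  obtain ⟨T', hT'T, hψ0⟩ := hψ.2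
  have hψT : ψ T x = 0 := by rw [hψ0 T hT'T.le]; rfl
  rw [hψT, mul_zero] at hprod
  -- `(0,T)` versus `(0,T]`
  rw [setIntegral_congr_set (Ioo_ae_eq_Ioc (μ := volume) (a := 0) (b := T))]
  have e : ∫ s in Ioc 0 T, (φ s * ψ s x + F s * γ s) = -(β c * ψ 0 x) := by linarith
  simpa only [hφ, hF, hP, hγ, mul_assoc] using e

/-! ## §2 The renormalised mollified equation tested against a space–time test field -/

/-- Pull back an `∀ᵐ s, ∀ x` statement to the product measure `(0,T) × T^d`. [folklore] -/
private theorem ae_prod_of_ae_forall {P : ℝ → UnitAddTorus d → Prop}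
    (h : ∀ᵐ s ∂((volume : Measure ℝ).restrict (Ioo 0 T)), ∀ x, P s x) :
    ∀ᵐ p ∂(((volume : Measure ℝ).restrict (Ioo 0 T)).prod (volume : Measure (UnitAddTorus d))), P p.1 p.2 := by
  have hq : Measure.QuasiMeasurePreserving (Prod.fst : ℝ × UnitAddTorus d → ℝ)
      (((volume : Measure ℝ).restrict (Ioo 0 T)).prod (volume : Measure (UnitAddTorus d)))
      ((volume : Measure ℝ).restrict (Ioo 0 T)) := Measure.quasiMeasurePreserving_fst
  filter_upwards [hq.ae h] with p hp
  exact hp p.2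

/-- `|β z| ≤ |β 0| + K |z|` for a `K`-Lipschitz `β`. [folklore] -/
private theorem abs_le_of_lipschitz {β : ℝ → ℝ} {K : ℝ≥0} (hβK : LipschitzWith K β) (z : ℝ) :
    |β z| ≤ |β 0| + K * |z| := by
  have h := hβK.dist_le_mul z 0
  rw [Real.dist_eq, Real.dist_eq, sub_zero] at h
  have := abs_sub_abs_le_abs_sub (β z) (β 0)
  linarith

/-- `‖β z‖ ≤ ‖β 0‖ + K ‖z‖` for a `K`-Lipschitz `β`. [folklore] -/
private theorem norm_apply_le_of_lipschitz {β : ℝ → ℝ} {K : ℝ≥0} (hβK : LipschitzWith K β) (z : ℝ) :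
    ‖β z‖ ≤ ‖β 0‖ + K * ‖z‖ := by
  simp only [Real.norm_eq_abs]
  exact abs_le_of_lipschitz hβK z

/-- `‖β z‖ₑ ≤ K ‖z‖ₑ + ‖β 0‖ₑ` for a `K`-Lipschitz `β`. [folklore] -/
private theorem enorm_apply_le_of_lipschitz {β : ℝ → ℝ} {K : ℝ≥0} (hβK : LipschitzWith K β) (z : ℝ) :
    ‖β z‖ₑ ≤ (K : ℝ≥0∞) * ‖z‖ₑ + ‖β 0‖ₑ := by
  have h1 : ‖β z‖ ≤ K * ‖z‖ + ‖β 0‖ := by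
    have := norm_apply_le_of_lipschitz hβK z
    linarith
  rw [← ofReal_norm, ← ofReal_norm z, ← ofReal_norm (β 0), ← ENNReal.ofReal_coe_nnreal,
    ← ENNReal.ofReal_mul K.coe_nonneg, ← ENNReal.ofReal_add (by positivity) (norm_nonneg _)]
  exact ENNReal.ofReal_le_ofReal h1

/-- `|∫ θ(y) k(x - y) dy| ≤ C_k ∫ |θ|` for an integrable slice and `‖k‖ ≤ C_k`. [folklore] -/
private theorem abs_molInt_le {δ k : UnitAddTorus d → ℝ} (hδ : Integrable δ volume) {Ck : ℝ}
    (hCk : ∀ z, ‖k z‖ ≤ Ck) (x : UnitAddTorus d) :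
    |∫ y, δ y * k (x - y)| ≤ Ck * ∫ y, |δ y| := by
  rw [← Real.norm_eq_abs, ← integral_const_mul]
  refine norm_integral_le_of_norm_le (hδ.abs.const_mul Ck) (Eventually.of_forall fun y => ?_)
  rw [norm_mul, Real.norm_eq_abs, mul_comm]
  exact mul_le_mul_of_nonneg_right (hCk _) (abs_nonneg _)

/-- **`β(A)` is essentially bounded on `(0,T) × T^d`** for the mollified solution `A = θ ⋆ k` of a weak
solution `θ ∈ L^∞(0,T; L²)` and a Lipschitz `β`: `|β(A(s,x))| ≤ |β(0)| + K C_k sup‖θ(s)‖₂`. [folklore] -/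
private theorem ae_forall_abs_comp_molInt_le {κ : ℝ} (h : IsWeakScalarTransportOn T κ u θ₀ θ)
    {k : UnitAddTorus d → ℝ} (hk : Continuous k) {β : ℝ → ℝ} {K : ℝ≥0} (hβK : LipschitzWith K β) :
    ∃ B : ℝ, ∀ᵐ s ∂((volume : Measure ℝ).restrict (Ioo 0 T)), ∀ x, |β (∫ y, θ s y * k (x - y))| ≤ B := by
  obtain ⟨Ck, hCk⟩ := FunctionSpaces.Torus.exists_forall_norm_le_of_continuous hk
  obtain ⟨C₁, hC₁⟩ := h.exists_eLpNorm_le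
  refine ⟨|β 0| + K * (Ck * C₁), ?_⟩
  filter_upwards [hC₁, h.ae_memLp_two] with s hs hm x
  refine (abs_le_of_lipschitz hβK _).trans (add_le_add le_rfl (mul_le_mul_of_nonneg_left ?_ K.coe_nonneg))
  exact (abs_molInt_le (hm.integrable one_le_two) hCk x).trans
    (mul_le_mul_of_nonneg_left (integral_abs_le_of_eLpNorm_le hm hs) ((norm_nonneg _).trans (hCk 0)))

/-- `β(A) Φ` is integrable on `(0,T) × T^d` for every integrable `Φ` (`β(A)` is essentially bounded). [folklore] -/
private theorem integrable_comp_molInt_mul {κ : ℝ} (h : IsWeakScalarTransportOn T κ u θ₀ θ)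
    {k : UnitAddTorus d → ℝ} (hk : Continuous k) {β : ℝ → ℝ} (hβc : Continuous β) {K : ℝ≥0}
    (hβK : LipschitzWith K β) {Φ : ℝ × UnitAddTorus d → ℝ}
    (hΦ : Integrable Φ (((volume : Measure ℝ).restrict (Ioo 0 T)).prod volume)) :
    Integrable (fun p : ℝ × UnitAddTorus d => β (∫ y, θ p.1 y * k (p.2 - y)) * Φ p)
      (((volume : Measure ℝ).restrict (Ioo 0 T)).prod volume) := by
  obtain ⟨B, hB⟩ := h.ae_forall_abs_comp_molInt_le hk hβK
  refine hΦ.bdd_mul (c := B) (hβc.comp_aestronglyMeasurable (h.aestronglyMeasurable_uncurry_molInt₁ hk)) ?_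
  filter_upwards [ae_prod_of_ae_forall (T := T) hB] with p hp
  rw [Real.norm_eq_abs]
  exact hp

/-- `β(θ) Φ` is integrable on `(0,T) × T^d` whenever `Φ` and `θ Φ` are (`|β(θ)| ≤ |β(0)| + K|θ|`). [folklore] -/
private theorem integrable_comp_mul {κ : ℝ} (h : IsWeakScalarTransportOn T κ u θ₀ θ) {β : ℝ → ℝ}
    (hβc : Continuous β) {K : ℝ≥0} (hβK : LipschitzWith K β) {Φ : ℝ × UnitAddTorus d → ℝ}
    (hΦ : Integrable Φ (((volume : Measure ℝ).restrict (Ioo 0 T)).prod volume))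
    (hθΦ : Integrable (fun p : ℝ × UnitAddTorus d => θ p.1 p.2 * Φ p)
      (((volume : Measure ℝ).restrict (Ioo 0 T)).prod volume)) :
    Integrable (fun p : ℝ × UnitAddTorus d => β (θ p.1 p.2) * Φ p)
      (((volume : Measure ℝ).restrict (Ioo 0 T)).prod volume) := by
  refine Integrable.mono' ((hΦ.norm.const_mul ‖β 0‖).add (hθΦ.norm.const_mul K))
    ((hβc.comp_aestronglyMeasurable h.aestronglyMeasurable_uncurry).mul hΦ.1) ?_
  filter_upwards with p
  rw [norm_mul]
  have := norm_apply_le_of_lipschitz hβK (θ p.1 p.2)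
  calc ‖β (θ p.1 p.2)‖ * ‖Φ p‖ ≤ (‖β 0‖ + K * ‖θ p.1 p.2‖) * ‖Φ p‖ := by gcongr
    _ = ‖β 0‖ * ‖Φ p‖ + K * ‖θ p.1 p.2 * Φ p‖ := by rw [norm_mul]; ring

/-- **The renormalised flux pairing `β'(A) G ψ` is integrable on `(0,T) × T^d`** (`β'` bounded, `G`
dominated by an `L¹(0,T)` majorant uniformly in `x`, `ψ` bounded). [folklore] -/
private theorem integrable_renorm_flux_test (h : IsWeakScalarTransportOn T 0 u θ₀ θ)
    {k : UnitAddTorus d → ℝ} (hk : FunctionSpaces.Torus.IsSmooth k)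
    {β : ℝ → ℝ} (hβ : ContDiff ℝ 1 β) {K : ℝ≥0} (hβK : LipschitzWith K β)
    {ψ : ℝ → UnitAddTorus d → ℝ} (hψ : FunctionSpaces.Torus.IsSpaceTimeTest T ψ) :
    Integrable (fun p : ℝ × UnitAddTorus d => deriv β (∫ y, θ p.1 y * k (p.2 - y)) *
        (∫ y, θ p.1 y * (-⟪u p.1 y, FunctionSpaces.Torus.gradient k (p.2 - y)⟫_ℝ +
          0 * FunctionSpaces.Torus.laplacian k (p.2 - y))) * ψ p.1 p.2)
      (((volume : Measure ℝ).restrict (Ioo 0 T)).prod volume) := by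
  set μT : Measure ℝ := (volume : Measure ℝ).restrict (Ioo 0 T) with hμT
  have hβ' : ∀ z, ‖deriv β z‖ ≤ K := fun z => norm_deriv_le_of_lipschitz hβK
  have hψc : Continuous (uncurry ψ) :=
    FunctionSpaces.Torus.continuous_uncurry_of_continuous_stLift hψ.1.continuous
  obtain ⟨Cψ, hCψ⟩ := exists_bound_of_continuous_uncurry hψc 0 T
  obtain ⟨bound, hbi, hGb⟩ := h.exists_flux_bound₁ hk
  have hAm := h.aestronglyMeasurable_uncurry_molInt₁ hk.continuous
  have hGm := h.aestronglyMeasurable_uncurry_flux₁ hk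
  have hψm : AEStronglyMeasurable (uncurry ψ) (μT.prod volume) := hψc.aestronglyMeasurable
  have hpT : ∀ᵐ p : ℝ × UnitAddTorus d ∂(μT.prod volume), p.1 ∈ Ioo 0 T :=
    ae_prod_of_ae_forall (T := T) ((ae_restrict_mem measurableSet_Ioo).mono fun s hs _ => hs)
  refine Integrable.mono' ((Integrable.mul_prod (hbi : Integrable bound μT)
    (integrable_const (1 : ℝ) (μ := (volume : Measure (UnitAddTorus d))))).const_mul (K * Cψ))
    ((((hβ.continuous_deriv le_rfl).comp_aestronglyMeasurable hAm).mul hGm).mul hψm) ?_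
  filter_upwards [ae_prod_of_ae_forall (T := T) hGb, hpT] with p hp hpT'
  simp only [norm_mul, mul_one]
  have h1 : ‖deriv β (∫ y, θ p.1 y * k (p.2 - y))‖ ≤ K := hβ' _
  have h2 := hp
  have h3 : ‖ψ p.1 p.2‖ ≤ Cψ := hCψ p.1 (Ioo_subset_Icc_self hpT') p.2
  have hb0 : 0 ≤ bound p.1 := (norm_nonneg _).trans h2
  calc ‖deriv β (∫ y, θ p.1 y * k (p.2 - y))‖ *
        ‖∫ y, θ p.1 y * (-⟪u p.1 y, FunctionSpaces.Torus.gradient k (p.2 - y)⟫_ℝ +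
          0 * FunctionSpaces.Torus.laplacian k (p.2 - y))‖ * ‖ψ p.1 p.2‖ ≤ K * bound p.1 * Cψ := by
        gcongr
    _ = K * Cψ * bound p.1 := by ring

/-- **The renormalised mollified equation, tested against a space–time test field** (DiPerna–Lions 1989,
§II.3): with `A = θ ⋆ k`, `A⁰ = θ₀ ⋆ k` and the flux `G`,
`∫₀ᵀ∫ β(A) ∂ₜψ + ∫ β(A⁰) ψ(0) = -∫₀ᵀ∫ β'(A) G ψ` (§1 at every `x`, the a.e.-in-time identity
`A = A⁰ + ∫₀ᵗ G` simultaneously in `x`, and Fubini). [cite: DiPernaLions1989, §II.3 Thm. II.3 (proof)] -/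
theorem renorm_mollified_test_identity (h : IsWeakScalarTransportOn T 0 u θ₀ θ) (hT : 0 < T)
    (hθ₀ : Integrable θ₀ volume) {k : UnitAddTorus d → ℝ} (hk : FunctionSpaces.Torus.IsSmooth k)
    {β : ℝ → ℝ} (hβ : ContDiff ℝ 1 β) {K : ℝ≥0} (hβK : LipschitzWith K β)
    {ψ : ℝ → UnitAddTorus d → ℝ} (hψ : FunctionSpaces.Torus.IsSpaceTimeTest T ψ) :
    (∫ s in Ioo 0 T, ∫ x, β (∫ y, θ s y * k (x - y)) * FunctionSpaces.Torus.timeDeriv ψ s x) +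
        ∫ x, β (∫ y, θ₀ y * k (x - y)) * ψ 0 x =
      -(∫ s in Ioo 0 T, ∫ x, deriv β (∫ y, θ s y * k (x - y)) *
          (∫ y, θ s y * (-⟪u s y, FunctionSpaces.Torus.gradient k (x - y)⟫_ℝ + 0 * FunctionSpaces.Torus.laplacian k (x - y))) *
          ψ s x) := by
  set μT : Measure ℝ := (volume : Measure ℝ).restrict (Ioo 0 T) with hμT
  haveI : IsFiniteMeasure μT := by rw [hμT]; infer_instance
  set P : Measure (ℝ × UnitAddTorus d) := μT.prod volume with hP
  -- notation
  set A : ℝ → UnitAddTorus d → ℝ := fun s x => ∫ y, θ s y * k (x - y) with hA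
  set A₀ : UnitAddTorus d → ℝ := fun x => ∫ y, θ₀ y * k (x - y) with hA₀
  set G : ℝ → UnitAddTorus d → ℝ := fun s x => ∫ y, θ s y *
    (-⟪u s y, FunctionSpaces.Torus.gradient k (x - y)⟫_ℝ + 0 * FunctionSpaces.Torus.laplacian k (x - y)) with hG
  set γ : ℝ → UnitAddTorus d → ℝ := fun s x => FunctionSpaces.Torus.timeDeriv ψ s x with hγ
  set I₁ : ℝ × UnitAddTorus d → ℝ := fun p => deriv β (A p.1 p.2) * G p.1 p.2 * ψ p.1 p.2 with hI₁
  set I₂ : ℝ × UnitAddTorus d → ℝ := fun p => β (A p.1 p.2) * γ p.1 p.2 with hI₂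
  obtain ⟨Cγ, hCγ⟩ := exists_bound_of_continuous_uncurry hψ.continuous_uncurry_timeDeriv 0 T
  have hpT : ∀ᵐ p ∂P, p.1 ∈ Ioo 0 T :=
    ae_prod_of_ae_forall (T := T) ((ae_restrict_mem measurableSet_Ioo).mono fun s hs _ => hs)
  -- integrability of `I₁` and `I₂`
  have hI₁i : Integrable I₁ P := h.integrable_renorm_flux_test hk hβ hβK hψ
  have hγi : Integrable (fun p : ℝ × UnitAddTorus d => γ p.1 p.2) P := by
    refine Integrable.mono' (integrable_const Cγ) hψ.continuous_uncurry_timeDeriv.aestronglyMeasurable ?_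
    filter_upwards [hpT] with p hp
    exact hCγ p.1 (Ioo_subset_Icc_self hp) p.2
  have hI₂i : Integrable I₂ P := h.integrable_comp_molInt_mul hk.continuous hβ.continuous hβK hγi
  -- §1 at every `x`, rewritten along the a.e.-in-time identity `A = A₀ + ∫ G`
  have hS := h.ae_forall_molInt_eq_datum_add_setIntegral_flux hθ₀ hk
  have hx : ∀ x, ∫ s in Ioo 0 T, (I₁ (s, x) + I₂ (s, x)) = -(β (A₀ x) * ψ 0 x) := by
    intro x
    rw [← setIntegral_renorm_primitive_test h hT hk hβ hβK hψ x]
    refine integral_congr_ae ?_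
    filter_upwards [hS] with s hs
    simp only [hI₁, hI₂, hA, hG, hγ]
    rw [hs x]
  -- integrate in `x` and swap
  have hsum : Integrable (fun p => I₁ p + I₂ p) P := hI₁i.add hI₂i
  have e1 : ∫ x, ∫ s in Ioo 0 T, (I₁ (s, x) + I₂ (s, x)) = ∫ p, (I₁ p + I₂ p) ∂P := by
    rw [integral_prod_symm _ hsum]
  have e2 : ∫ p, (I₁ p + I₂ p) ∂P = (∫ s in Ioo 0 T, ∫ x, I₁ (s, x)) + ∫ s in Ioo 0 T, ∫ x, I₂ (s, x) := by
    rw [integral_add hI₁i hI₂i, integral_prod _ hI₁i, integral_prod _ hI₂i]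
  have e3 : ∫ x, ∫ s in Ioo 0 T, (I₁ (s, x) + I₂ (s, x)) = -∫ x, β (A₀ x) * ψ 0 x := by
    rw [integral_congr_ae (Eventually.of_forall hx), integral_neg]
  have key : (∫ s in Ioo 0 T, ∫ x, I₁ (s, x)) + ∫ s in Ioo 0 T, ∫ x, I₂ (s, x) = -∫ x, β (A₀ x) * ψ 0 x := by
    rw [← e2, ← e1, e3]
  simp only [hI₁, hI₂, hA, hA₀, hG, hγ] at key
  linarith

end IsWeakScalarTransportOn

/-! ## §3 Slice algebra: the flux against `β'(A)φ` -/

section Slice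

variable {β : ℝ → ℝ} {A φ δ k : UnitAddTorus d → ℝ} {v : UnitAddTorus d → EuclideanSpace ℝ d}

/-- **Weak incompressibility against the renormalised test function `β(A)φ`**:
`∫ β'(A) ⟪v, ∇A⟫ φ = -∫ β(A) ⟪v, ∇φ⟫` for an integrable weakly divergence-free `v` and smooth
`A`, `φ`, `β` (`∇(β(A)φ) = β(A)∇φ + φ β'(A)∇A`). [folklore] -/
private theorem integral_deriv_comp_mul_inner_gradient_mul_eq (hβ : ContDiff ℝ ∞ β)
    (hA : FunctionSpaces.Torus.IsSmooth A) (hφ : FunctionSpaces.Torus.IsSmooth φ)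
    (hv : Integrable v volume) (hdiv : FunctionSpaces.Torus.IsWeaklyDivFree v) :
    ∫ x, deriv β (A x) * ⟪v x, FunctionSpaces.Torus.gradient A x⟫_ℝ * φ x =
      -∫ x, β (A x) * ⟪v x, FunctionSpaces.Torus.gradient φ x⟫_ℝ := by
  have hA1 : FunctionSpaces.Torus.IsContDiff 1 A := hA.isContDiff (by simp)
  have hφ1 : FunctionSpaces.Torus.IsContDiff 1 φ := hφ.isContDiff (by simp)
  have hβ1 : ContDiff ℝ 1 β := hβ.of_le (by simp)
  have hβA : FunctionSpaces.Torus.IsSmooth (β ∘ A) := hA.comp_left hβ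
  have hβA1 : FunctionSpaces.Torus.IsContDiff 1 (β ∘ A) := hβA.isContDiff (by simp)
  have hprod : FunctionSpaces.Torus.IsSmooth (fun x => (β ∘ A) x * φ x) :=
    (ContDiff.mul hβA hφ : FunctionSpaces.Torus.IsSmooth fun x => (β ∘ A) x * φ x)
  have h0 := hdiv _ hprod
  -- bounds
  have hβAc : Continuous fun x => β (A x) := hβ.continuous.comp hA.continuous
  have hβ'Ac : Continuous fun x => deriv β (A x) := (hβ.continuous_deriv (by simp)).comp hA.continuous
  obtain ⟨Cb, hCb⟩ := FunctionSpaces.Torus.exists_forall_norm_le_of_continuous hβAc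
  obtain ⟨Cb', hCb'⟩ := FunctionSpaces.Torus.exists_forall_norm_le_of_continuous hβ'Ac
  obtain ⟨Cg, hCg⟩ := FunctionSpaces.Torus.exists_forall_norm_le_of_continuous hφ.gradient.continuous
  obtain ⟨CgA, hCgA⟩ := FunctionSpaces.Torus.exists_forall_norm_le_of_continuous hA.gradient.continuous
  obtain ⟨Cφ, hCφ⟩ := FunctionSpaces.Torus.exists_forall_norm_le_of_continuous hφ.continuous
  have iφ : Integrable (fun x => ⟪v x, FunctionSpaces.Torus.gradient φ x⟫_ℝ) volume := by
    refine Integrable.mono' (hv.norm.mul_const Cg)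
      (hv.aestronglyMeasurable.inner hφ.gradient.continuous.aestronglyMeasurable)
      (Eventually.of_forall fun x => ?_)
    exact (norm_inner_le_norm _ _).trans (mul_le_mul_of_nonneg_left (hCg _) (norm_nonneg _))
  have iA : Integrable (fun x => ⟪v x, FunctionSpaces.Torus.gradient A x⟫_ℝ) volume := by
    refine Integrable.mono' (hv.norm.mul_const CgA)
      (hv.aestronglyMeasurable.inner hA.gradient.continuous.aestronglyMeasurable)
      (Eventually.of_forall fun x => ?_)
    exact (norm_inner_le_norm _ _).trans (mul_le_mul_of_nonneg_left (hCgA _) (norm_nonneg _))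
  have i1 : Integrable (fun x => β (A x) * ⟪v x, FunctionSpaces.Torus.gradient φ x⟫_ℝ) volume :=
    iφ.bdd_mul (c := Cb) hβAc.aestronglyMeasurable (Eventually.of_forall hCb)
  have i2 : Integrable (fun x => deriv β (A x) * ⟪v x, FunctionSpaces.Torus.gradient A x⟫_ℝ * φ x) volume :=
    (iA.bdd_mul (c := Cb') hβ'Ac.aestronglyMeasurable (Eventually.of_forall hCb')).mul_bdd (c := Cφ)
      hφ.continuous.aestronglyMeasurable (Eventually.of_forall hCφ)
  have e : (fun x => ⟪v x, FunctionSpaces.Torus.gradient (fun y => (β ∘ A) y * φ y) x⟫_ℝ) =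
      fun x => β (A x) * ⟪v x, FunctionSpaces.Torus.gradient φ x⟫_ℝ +
        deriv β (A x) * ⟪v x, FunctionSpaces.Torus.gradient A x⟫_ℝ * φ x := by
    funext x
    rw [gradient_mul hβA1 hφ1, inner_add_right, real_inner_smul_right, real_inner_smul_right,
      gradient_comp_left hβ1 hA1, real_inner_smul_right, Function.comp_apply]
    ring
  rw [e, integral_add i1 i2] at h0
  linarith

/-- **Slice algebra for the renormalised flux** (DiPerna–Lions 1989, §II.3): for an integrable weakly
divergence-free `v` with `‖v‖δ ∈ L¹`, `δ ∈ L¹`, smooth `k`, `φ`, `β`, with `A = δ ⋆ k`, the flux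
`G(x) = ∫ δ(y)(-⟪v(y), ∇k(x-y)⟫) dy` and the commutator `r(x) = ∫ δ(y) ⟪v(x) - v(y), ∇k(x-y)⟫ dy`:
`∫ β'(A) G φ = ∫ β'(A) r φ + ∫ β(A) ⟪v, ∇φ⟫`. [cite: DiPernaLions1989, §II.3 Thm. II.3 (proof)] -/
theorem integral_deriv_comp_mul_flux_mul_test (hβ : ContDiff ℝ ∞ β) (hδ : Integrable δ volume)
    (hv : Integrable v volume) (hvδ : Integrable (fun y => ‖v y‖ * δ y) volume)
    (hdiv : FunctionSpaces.Torus.IsWeaklyDivFree v) (hk : FunctionSpaces.Torus.IsSmooth k)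
    (hφ : FunctionSpaces.Torus.IsSmooth φ) :
    ∫ x, deriv β ((δ ⋆ k) x) *
        (∫ y, δ y * (-⟪v y, FunctionSpaces.Torus.gradient k (x - y)⟫_ℝ + 0 * FunctionSpaces.Torus.laplacian k (x - y))) *
        φ x =
      (∫ x, deriv β ((δ ⋆ k) x) * (∫ y, δ y * ⟪v x - v y, FunctionSpaces.Torus.gradient k (x - y)⟫_ℝ) * φ x) +
        ∫ x, β ((δ ⋆ k) x) * ⟪v x, FunctionSpaces.Torus.gradient φ x⟫_ℝ := by
  have hA : FunctionSpaces.Torus.IsSmooth (δ ⋆ k) := FunctionSpaces.Torus.isSmooth_convolution hδ hk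
  have hβ'c : Continuous fun x => deriv β ((δ ⋆ k) x) := (hβ.continuous_deriv (by simp)).comp hA.continuous
  obtain ⟨Cb', hCb'⟩ := FunctionSpaces.Torus.exists_forall_norm_le_of_continuous hβ'c
  obtain ⟨CgA, hCgA⟩ := FunctionSpaces.Torus.exists_forall_norm_le_of_continuous hA.gradient.continuous
  obtain ⟨Cφ, hCφ⟩ := FunctionSpaces.Torus.exists_forall_norm_le_of_continuous hφ.continuous
  have hGc := continuous_fluxIntegral hδ hv.aestronglyMeasurable hvδ hk 0
  have hsplit := fun x => fluxIntegral_eq_comm_sub_add_of_integrable hδ hv.aestronglyMeasurable hvδ hk 0 x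
  have jG : Integrable (fun x => deriv β ((δ ⋆ k) x) *
      (∫ y, δ y * (-⟪v y, FunctionSpaces.Torus.gradient k (x - y)⟫_ℝ + 0 * FunctionSpaces.Torus.laplacian k (x - y))) *
      φ x) volume :=
    ((hβ'c.mul hGc).mul hφ.continuous).integrable_unitAddTorus
  have iA : Integrable (fun x => ⟪v x, FunctionSpaces.Torus.gradient (δ ⋆ k) x⟫_ℝ) volume := by
    refine Integrable.mono' (hv.norm.mul_const CgA)
      (hv.aestronglyMeasurable.inner hA.gradient.continuous.aestronglyMeasurable)
      (Eventually.of_forall fun x => ?_)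
    exact (norm_inner_le_norm _ _).trans (mul_le_mul_of_nonneg_left (hCgA _) (norm_nonneg _))
  have j2 : Integrable (fun x => deriv β ((δ ⋆ k) x) * ⟪v x, FunctionSpaces.Torus.gradient (δ ⋆ k) x⟫_ℝ * φ x)
      volume :=
    (iA.bdd_mul (c := Cb') hβ'c.aestronglyMeasurable (Eventually.of_forall hCb')).mul_bdd (c := Cφ)
      hφ.continuous.aestronglyMeasurable (Eventually.of_forall hCφ)
  have hr : (fun x => deriv β ((δ ⋆ k) x) * (∫ y, δ y * ⟪v x - v y, FunctionSpaces.Torus.gradient k (x - y)⟫_ℝ) * φ x) =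
      fun x => deriv β ((δ ⋆ k) x) *
          (∫ y, δ y * (-⟪v y, FunctionSpaces.Torus.gradient k (x - y)⟫_ℝ + 0 * FunctionSpaces.Torus.laplacian k (x - y))) *
          φ x +
        deriv β ((δ ⋆ k) x) * ⟪v x, FunctionSpaces.Torus.gradient (δ ⋆ k) x⟫_ℝ * φ x := by
    funext x
    rw [hsplit x]
    ring
  have j1 : Integrable (fun x => deriv β ((δ ⋆ k) x) *
      (∫ y, δ y * ⟪v x - v y, FunctionSpaces.Torus.gradient k (x - y)⟫_ℝ) * φ x) volume := by
    rw [hr]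
    exact jG.add j2
  have e : (fun x => deriv β ((δ ⋆ k) x) *
      (∫ y, δ y * (-⟪v y, FunctionSpaces.Torus.gradient k (x - y)⟫_ℝ + 0 * FunctionSpaces.Torus.laplacian k (x - y))) *
      φ x) =
      fun x => deriv β ((δ ⋆ k) x) * (∫ y, δ y * ⟪v x - v y, FunctionSpaces.Torus.gradient k (x - y)⟫_ℝ) * φ x -
        deriv β ((δ ⋆ k) x) * ⟪v x, FunctionSpaces.Torus.gradient (δ ⋆ k) x⟫_ℝ * φ x := by
    funext x
    rw [hsplit x]
    ring
  rw [e, integral_sub j1 j2, integral_deriv_comp_mul_inner_gradient_mul_eq hβ hA hφ hv hdiv]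
  ring

end Slice

/-! ## §4 Passage to the limit: the renormalisation theorem for smooth Lipschitz `β` -/

namespace IsWeakScalarTransportOn

variable {T : ℝ} {u : ℝ → UnitAddTorus d → EuclideanSpace ℝ d} {θ₀ : UnitAddTorus d → ℝ}
  {θ : ℝ → UnitAddTorus d → ℝ}

/-- Joint measurability of the commutator `r(s,x) = ∫ θ(s,y) ⟪u(s,x) - u(s,y), ∇k(x-y)⟫ dy` of a single
solution. [folklore] -/
private theorem aestronglyMeasurable_uncurry_commutator {κ : ℝ} (h : IsWeakScalarTransportOn T κ u θ₀ θ)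
    {k : UnitAddTorus d → ℝ} (hk : FunctionSpaces.Torus.IsSmooth k) :
    AEStronglyMeasurable (uncurry fun s x => ∫ y, θ s y *
      ⟪u s x - u s y, FunctionSpaces.Torus.gradient k (x - y)⟫_ℝ)
      (((volume : Measure ℝ).restrict (Ioo 0 T)).prod volume) := by
  set Ψ : (ℝ × UnitAddTorus d) × UnitAddTorus d → ℝ := fun q => θ q.1.1 q.2 *
    ⟪u q.1.1 q.1.2 - u q.1.1 q.2, FunctionSpaces.Torus.gradient k (q.1.2 - q.2)⟫_ℝ with hΨ
  have hsub : AEStronglyMeasurable (fun q : (ℝ × UnitAddTorus d) × UnitAddTorus d => q.1.2 - q.2)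
      ((((volume : Measure ℝ).restrict (Ioo 0 T)).prod volume).prod volume) :=
    (measurable_fst.snd.sub measurable_snd).aestronglyMeasurable
  have hΨm : AEStronglyMeasurable Ψ ((((volume : Measure ℝ).restrict (Ioo 0 T)).prod volume).prod volume) := by
    refine (FunctionSpaces.Torus.aestronglyMeasurable_comp_fst_snd h.aestronglyMeasurable_uncurry).mul ?_
    exact ((FunctionSpaces.Torus.aestronglyMeasurable_comp_fst h.aestronglyMeasurable_uncurry_velocity).sub
      (FunctionSpaces.Torus.aestronglyMeasurable_comp_fst_snd h.aestronglyMeasurable_uncurry_velocity)).inner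
      (hk.gradient.continuous.comp_aestronglyMeasurable hsub)
  have e : (uncurry fun s x => ∫ y, θ s y * ⟪u s x - u s y, FunctionSpaces.Torus.gradient k (x - y)⟫_ℝ) =
      fun p => ∫ y, Ψ (p, y) := by
    funext p
    rfl
  rw [e]
  exact hΨm.integral_prod_right'

/-- `‖f‖_{L²} = (∫⁻ ‖f‖ₑ²)^{1/2}`. [folklore] -/
private theorem eLpNorm_two_eq_lintegral_rpow_half {α : Type*} [MeasurableSpace α] {μ : Measure α}
    {E : Type*} [NormedAddCommGroup E] (f : α → E) :
    eLpNorm f 2 μ = (∫⁻ x, ‖f x‖ₑ ^ 2 ∂μ) ^ (1 / 2 : ℝ) := by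
  rw [eLpNorm_eq_lintegral_rpow_enorm_toReal two_ne_zero ENNReal.ofNat_ne_top, ENNReal.toReal_ofNat]
  congr 1
  exact lintegral_congr fun x => by rw [ENNReal.rpow_two]

/-- `u ∈ L¹((0,T) × T^d)` for the velocity of a weak solution (`L¹_t L²_x ⊂ L¹_{t,x}` on the
probability space `T^d`). [folklore] -/
private theorem integrable_uncurry_velocity {κ : ℝ} (h : IsWeakScalarTransportOn T κ u θ₀ θ) :
    Integrable (uncurry u) (((volume : Measure ℝ).restrict (Ioo 0 T)).prod volume) := by
  refine ⟨h.aestronglyMeasurable_uncurry_velocity, ?_⟩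
  rw [hasFiniteIntegral_iff_enorm, lintegral_prod _ h.aestronglyMeasurable_uncurry_velocity.enorm]
  refine lt_of_le_of_lt (lintegral_mono_ae ?_) h.lintegral_velocity_lt_top
  filter_upwards [h.ae_aestronglyMeasurable_velocity_slice] with t hm
  rw [← eLpNorm_two_eq_lintegral_rpow_half (u t),
    show (∫⁻ x, ‖uncurry u (t, x)‖ₑ) = eLpNorm (u t) 1 volume by rw [eLpNorm_one_eq_lintegral_enorm]; rfl]
  exact eLpNorm_le_eLpNorm_of_exponent_le (by norm_num) hm

/-- Cauchy–Schwarz with the extended norm: `‖∫ A r‖ₑ ≤ ‖A‖_{L²} ‖r‖_{L²}`. [folklore] -/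
private theorem enorm_integral_mul_le_eLpNorm_two {A r : UnitAddTorus d → ℝ} (hA : AEStronglyMeasurable A volume)
    (hr : AEStronglyMeasurable r volume) :
    ‖∫ x, A x * r x‖ₑ ≤ eLpNorm A 2 volume * eLpNorm r 2 volume := by
  refine (enorm_integral_le_lintegral_enorm _).trans ?_
  simp_rw [enorm_mul]
  have h := ENNReal.lintegral_mul_le_Lp_mul_Lq (volume : Measure (UnitAddTorus d))
    Real.HolderConjugate.two_two hA.enorm hr.enorm
  rw [eLpNorm_eq_lintegral_rpow_enorm_toReal two_ne_zero ENNReal.ofNat_ne_top,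
    eLpNorm_eq_lintegral_rpow_enorm_toReal two_ne_zero ENNReal.ofNat_ne_top, ENNReal.toReal_ofNat]
  exact h

/-- **Lipschitz pairing bound**: `‖∫ (β(a) - β(b)) φ‖ₑ ≤ K ‖a - b‖_{L²} ‖φ‖_{L²}`. [folklore] -/
private theorem enorm_integral_comp_sub_comp_mul_le {a b φ : UnitAddTorus d → ℝ} (ha : AEStronglyMeasurable a volume)
    (hb : AEStronglyMeasurable b volume) (hφ : AEStronglyMeasurable φ volume) {β : ℝ → ℝ}
    (hβc : Continuous β) {K : ℝ≥0} (hβK : LipschitzWith K β) :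
    ‖∫ x, (β (a x) - β (b x)) * φ x‖ₑ ≤ (K : ℝ≥0∞) * eLpNorm (a - b) 2 volume * eLpNorm φ 2 volume := by
  have hm : AEStronglyMeasurable (fun x => β (a x) - β (b x)) volume :=
    (hβc.comp_aestronglyMeasurable ha).sub (hβc.comp_aestronglyMeasurable hb)
  refine (enorm_integral_mul_le_eLpNorm_two hm hφ).trans ?_
  gcongr
  have h1 : eLpNorm (fun x => β (a x) - β (b x)) 2 volume ≤ ENNReal.ofReal K * eLpNorm (a - b) 2 volume :=
    eLpNorm_le_mul_eLpNorm_of_ae_le_mul (Eventually.of_forall fun x => by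
      rw [Pi.sub_apply]
      exact hβK.norm_sub_le (a x) (b x)) 2
  rwa [ENNReal.ofReal_coe_nnreal] at h1

/-- Continuous functions on the torus are in `L²`. [folklore] -/
private theorem memLp_two_of_continuous {f : UnitAddTorus d → ℝ} (hf : Continuous f) : MemLp f 2 volume := by
  obtain ⟨C, hC⟩ := FunctionSpaces.Torus.exists_forall_norm_le_of_continuous hf
  exact (memLp_top_of_bound hf.aestronglyMeasurable C (Eventually.of_forall hC)).mono_exponent le_top

/-- **The DiPerna–Lions renormalisation theorem for Lipschitz drifts, smooth `β`** (DiPerna–Lions 1989,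
§II.3, Thm. II.3 and Cor. II.1; Ambrosio–Crippa 2014, Thm. 4.4 / proof of Thm. 4.6): for a drift with
`u(t)` `L(t)`-Lipschitz for a.e. `t ∈ (0,T)` and `∫₀ᵀ L < ∞` (and the standing `u ∈ L¹_t L²_x`, weakly
divergence free a.e. in time), a datum `θ₀ ∈ L²`, a weak solution `θ` of `∂ₜθ + u·∇θ = 0` on `[0,T)` in
the class `IsWeakScalarTransportOn T 0 u θ₀ θ`, and `β ∈ C^∞(ℝ)` globally Lipschitz, the composite
`β ∘ θ` is a weak solution with datum `β ∘ θ₀`.  Proof: §1–§3 along the mollifier sequence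
`kₙ = kernel (1/(4(n+1)))`, then `n → ∞`: `β(θ ⋆ kₙ) → β(θ)` against `∂ₜψ + u·∇ψ` (slice-wise
Cauchy–Schwarz, `θ(s) ⋆ kₙ → θ(s)` in `L²`, dominated convergence in time against
`C(1 + ‖u(s)‖₂)`), `β(θ₀ ⋆ kₙ) → β(θ₀)` against `ψ(0)`, and the commutator term
`∫∫ β'(Aₙ) rₙ ψ → 0` by the commutator lemma (`Torus.eLpNorm_comm_le`, `Torus.tendsto_eLpNorm_comm`)
and dominated convergence against `C L(s)`. [cite: DiPernaLions1989, §II.3 Thm. II.3, Cor. II.1] -/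
theorem comp_of_lipschitz_of_contDiff (h : IsWeakScalarTransportOn T 0 u θ₀ θ) (hθ₀ : MemLp θ₀ 2 volume)
    {β : ℝ → ℝ} (hβ : ContDiff ℝ ∞ β) {K : ℝ≥0} (hβK : LipschitzWith K β)
    {L : ℝ → ℝ≥0} (hlip : ∀ᵐ t ∂((volume : Measure ℝ).restrict (Ioo 0 T)), LipschitzWith (L t) (u t))
    (hL : ∫⁻ t in Ioo 0 T, (L t : ℝ≥0∞) < ⊤) :
    IsWeakScalarTransportOn T 0 u (fun x => β (θ₀ x)) (fun t x => β (θ t x)) where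
  aestronglyMeasurable := hβ.continuous.comp_aestronglyMeasurable h.aestronglyMeasurable
  aestronglyMeasurable_velocity := h.aestronglyMeasurable_velocity
  ae_lintegral_sq_le := by
    obtain ⟨C₁, hC₁⟩ := h.exists_eLpNorm_le
    refine ⟨(K * C₁ + ‖β 0‖₊) ^ 2, ?_⟩
    filter_upwards [hC₁, h.ae_aestronglyMeasurable_slice] with t ht hm
    rw [← PassiveScalarProofs.eLpNorm_two_pow_two, ENNReal.coe_pow]
    refine pow_le_pow_left' ?_ 2
    have hm1 : AEStronglyMeasurable (fun x => β (θ t x) - β 0) volume :=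
      (hβ.continuous.comp_aestronglyMeasurable hm).sub aestronglyMeasurable_const
    have e : (fun x => β (θ t x)) = (fun x => β (θ t x) - β 0) + fun _ => β 0 := by
      funext x
      simp
    rw [e]
    refine (eLpNorm_add_le hm1 aestronglyMeasurable_const one_le_two).trans ?_
    rw [ENNReal.coe_add, ENNReal.coe_mul]
    refine add_le_add ?_ ?_
    · have h1 : eLpNorm (fun x => β (θ t x) - β 0) 2 volume ≤ ENNReal.ofReal K * eLpNorm (θ t) 2 volume :=
        eLpNorm_le_mul_eLpNorm_of_ae_le_mul (Eventually.of_forall fun x => by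
          have := hβK.norm_sub_le (θ t x) 0
          rwa [sub_zero] at this) 2
      rw [ENNReal.ofReal_coe_nnreal] at h1
      exact h1.trans (by gcongr)
    · refine (eLpNorm_le_of_ae_bound (C := ‖β 0‖) (Eventually.of_forall fun _ => le_rfl)).trans ?_
      simp
  lintegral_velocity_lt_top := h.lintegral_velocity_lt_top
  lintegral_mul_lt_top := by
    set μT : Measure ℝ := (volume : Measure ℝ).restrict (Ioo 0 T) with hμT
    have hmu := h.aestronglyMeasurable_uncurry_velocity
    have hmθ := h.aestronglyMeasurable_uncurry
    have hF : AEMeasurable (fun p : ℝ × UnitAddTorus d => ‖u p.1 p.2‖ₑ * ‖β (θ p.1 p.2)‖ₑ) (μT.prod volume) :=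
      hmu.enorm.mul (hβ.continuous.comp_aestronglyMeasurable hmθ).enorm
    have hF₁ : AEMeasurable (fun p : ℝ × UnitAddTorus d => ‖u p.1 p.2‖ₑ * ‖θ p.1 p.2‖ₑ) (μT.prod volume) :=
      hmu.enorm.mul hmθ.enorm
    have hF₂ : AEMeasurable (fun p : ℝ × UnitAddTorus d => ‖u p.1 p.2‖ₑ) (μT.prod volume) := hmu.enorm
    rw [← lintegral_prod _ hF]
    have hle : ∫⁻ p, ‖u p.1 p.2‖ₑ * ‖β (θ p.1 p.2)‖ₑ ∂(μT.prod volume) ≤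
        (K : ℝ≥0∞) * (∫⁻ p, ‖u p.1 p.2‖ₑ * ‖θ p.1 p.2‖ₑ ∂(μT.prod volume)) +
          ‖β 0‖ₑ * ∫⁻ p, ‖u p.1 p.2‖ₑ ∂(μT.prod volume) := by
      rw [← lintegral_const_mul'' _ hF₁, ← lintegral_const_mul'' _ hF₂,
        ← lintegral_add_left' (hF₁.const_mul _)]
      refine lintegral_mono fun p => ?_
      calc ‖u p.1 p.2‖ₑ * ‖β (θ p.1 p.2)‖ₑ
          ≤ ‖u p.1 p.2‖ₑ * ((K : ℝ≥0∞) * ‖θ p.1 p.2‖ₑ + ‖β 0‖ₑ) := by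
            gcongr
            exact enorm_apply_le_of_lipschitz hβK _
        _ = (K : ℝ≥0∞) * (‖u p.1 p.2‖ₑ * ‖θ p.1 p.2‖ₑ) + ‖β 0‖ₑ * ‖u p.1 p.2‖ₑ := by ring
    refine lt_of_le_of_lt hle (ENNReal.add_lt_top.2 ⟨ENNReal.mul_lt_top ENNReal.coe_lt_top ?_,
      ENNReal.mul_lt_top enorm_lt_top ?_⟩)
    · rw [lintegral_prod _ hF₁]
      exact h.lintegral_mul_lt_top
    · have := h.integrable_uncurry_velocity.2
      rw [hasFiniteIntegral_iff_enorm] at this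
      exact this
  ae_isWeaklyDivFree := h.ae_isWeaklyDivFree
  weak_eq := by
    intro ψ hψ
    obtain ⟨T', hT'T, hT'⟩ := hψ.2
    rcases le_or_gt T 0 with hT | hT
    · have h0 : ψ 0 = 0 := hT' 0 (by linarith)
      rw [Ioo_eq_empty_of_le hT, Measure.restrict_empty, integral_zero_measure, zero_add, h0]
      simp
    simp only [zero_mul, add_zero]
    -- radii and kernels
    obtain ⟨hε, hε', hε0⟩ := molRadius_spec
    set ε : ℕ → ℝ := fun n => 1 / (4 * ((n : ℝ) + 1)) with hε_def
    have hkS : ∀ n, FunctionSpaces.Torus.IsSmooth (FunctionSpaces.Torus.kernel (d := d) (ε n)) := fun n =>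
      FunctionSpaces.Torus.isSmooth_kernel (hε n) (hε' n)
    have hkc : ∀ n, Continuous (FunctionSpaces.Torus.kernel (d := d) (ε n)) := fun n => (hkS n).continuous
    have hk1 : ∀ n, ∫⁻ y, ‖FunctionSpaces.Torus.kernel (d := d) (ε n) y‖ₑ = 1 := fun n =>
      FunctionSpaces.Torus.lintegral_enorm_kernel (hε n) (hε' n)
    have hconv : ∀ n (δ : UnitAddTorus d → ℝ) (x : UnitAddTorus d),
        ∫ y, δ y * FunctionSpaces.Torus.kernel (ε n) (x - y) = (δ ⋆ FunctionSpaces.Torus.kernel (ε n)) x :=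
      fun n δ x => by simp only [convolution_lsmul, smul_eq_mul]
    -- constants and bounds
    have hθ₀i : Integrable θ₀ volume := hθ₀.integrable one_le_two
    have hβ1 : ContDiff ℝ 1 β := hβ.of_le (by simp)
    have hβc : Continuous β := hβ.continuous
    have hβ'K : ∀ z, ‖deriv β z‖ₑ ≤ K := fun z => by
      rw [← ofReal_norm, ← ENNReal.ofReal_coe_nnreal]
      exact ENNReal.ofReal_le_ofReal (norm_deriv_le_of_lipschitz hβK)
    obtain ⟨C₁, hC₁⟩ := h.exists_eLpNorm_le
    have hψc : Continuous (uncurry ψ) :=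
      FunctionSpaces.Torus.continuous_uncurry_of_continuous_stLift hψ.1.continuous
    obtain ⟨Cψ, hCψ⟩ := exists_bound_of_continuous_uncurry hψc 0 T
    obtain ⟨Cγ, hCγ⟩ := exists_bound_of_continuous_uncurry hψ.continuous_uncurry_timeDeriv 0 T
    obtain ⟨Cg, hCg⟩ := exists_bound_of_continuous_uncurry hψ.continuous_uncurry_gradient 0 T
    have hsT : ∀ᵐ s ∂(volume.restrict (Ioo 0 T)), s ∈ Ioo 0 T := ae_restrict_mem measurableSet_Ioo
    have hpT : ∀ᵐ p : ℝ × UnitAddTorus d ∂((volume.restrict (Ioo 0 T)).prod volume), p.1 ∈ Ioo 0 T :=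
      ae_prod_of_ae_forall (T := T) (hsT.mono fun s hs _ => hs)
    -- measurability
    have hmθ := h.aestronglyMeasurable_uncurry
    have hmu := h.aestronglyMeasurable_uncurry_velocity
    have hγm : AEStronglyMeasurable (fun p : ℝ × UnitAddTorus d => FunctionSpaces.Torus.timeDeriv ψ p.1 p.2)
        ((volume.restrict (Ioo 0 T)).prod volume) := hψ.continuous_uncurry_timeDeriv.aestronglyMeasurable
    have hgm : AEStronglyMeasurable
        (fun p : ℝ × UnitAddTorus d => ⟪u p.1 p.2, FunctionSpaces.Torus.gradient (ψ p.1) p.2⟫_ℝ) ((volume.restrict (Ioo 0 T)).prod volume) :=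
      hmu.inner hψ.continuous_uncurry_gradient.aestronglyMeasurable
    -- integrability on `(0,T) × T^d` of the weights `∂ₜψ`, `u·∇ψ`, and of the limit pairing
    have hγi : Integrable (fun p : ℝ × UnitAddTorus d => FunctionSpaces.Torus.timeDeriv ψ p.1 p.2) ((volume.restrict (Ioo 0 T)).prod volume) := by
      refine Integrable.mono' (integrable_const Cγ) hγm ?_
      filter_upwards [hpT] with p hp
      exact hCγ p.1 (Ioo_subset_Icc_self hp) p.2
    have hgi : Integrable (fun p : ℝ × UnitAddTorus d => ⟪u p.1 p.2, FunctionSpaces.Torus.gradient (ψ p.1) p.2⟫_ℝ)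
        ((volume.restrict (Ioo 0 T)).prod volume) := by
      refine Integrable.mono' (h.integrable_uncurry_velocity.norm.mul_const Cg) hgm ?_
      filter_upwards [hpT] with p hp
      exact (norm_inner_le_norm _ _).trans
        (mul_le_mul_of_nonneg_left (hCg p.1 (Ioo_subset_Icc_self hp) p.2) (norm_nonneg _))
    have hθW : Integrable (fun p : ℝ × UnitAddTorus d => θ p.1 p.2 *
        (FunctionSpaces.Torus.timeDeriv ψ p.1 p.2 + ⟪u p.1 p.2, FunctionSpaces.Torus.gradient (ψ p.1) p.2⟫_ℝ))
        ((volume.restrict (Ioo 0 T)).prod volume) := by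
      simpa only [zero_mul, add_zero] using h.integrable_weakIntegrand hψ
    have hF : Integrable (fun p : ℝ × UnitAddTorus d => β (θ p.1 p.2) *
        (FunctionSpaces.Torus.timeDeriv ψ p.1 p.2 + ⟪u p.1 p.2, FunctionSpaces.Torus.gradient (ψ p.1) p.2⟫_ℝ))
        ((volume.restrict (Ioo 0 T)).prod volume) := h.integrable_comp_mul hβc hβK (hγi.add hgi) hθW
    -- the mollified pairings are integrable
    have hJγ : ∀ n, Integrable (fun p : ℝ × UnitAddTorus d =>
        β ((θ p.1 ⋆ FunctionSpaces.Torus.kernel (ε n)) p.2) * FunctionSpaces.Torus.timeDeriv ψ p.1 p.2)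
        ((volume.restrict (Ioo 0 T)).prod volume) := fun n =>
      (h.integrable_comp_molInt_mul (hkc n) hβc hβK hγi).congr (Eventually.of_forall fun p => by
        simp only [hconv])
    have hJg : ∀ n, Integrable (fun p : ℝ × UnitAddTorus d =>
        β ((θ p.1 ⋆ FunctionSpaces.Torus.kernel (ε n)) p.2) *
          ⟪u p.1 p.2, FunctionSpaces.Torus.gradient (ψ p.1) p.2⟫_ℝ) ((volume.restrict (Ioo 0 T)).prod volume) := fun n =>
      (h.integrable_comp_molInt_mul (hkc n) hβc hβK hgi).congr (Eventually.of_forall fun p => by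
        simp only [hconv])
    have hJ : ∀ n, Integrable (fun p : ℝ × UnitAddTorus d =>
        β ((θ p.1 ⋆ FunctionSpaces.Torus.kernel (ε n)) p.2) *
          (FunctionSpaces.Torus.timeDeriv ψ p.1 p.2 + ⟪u p.1 p.2, FunctionSpaces.Torus.gradient (ψ p.1) p.2⟫_ℝ))
        ((volume.restrict (Ioo 0 T)).prod volume) := fun n =>
      ((hJγ n).add (hJg n)).congr (Eventually.of_forall fun p => by
        simp only [Pi.add_apply]
        ring)
    have hI : ∀ n, Integrable (fun p : ℝ × UnitAddTorus d =>
        deriv β ((θ p.1 ⋆ FunctionSpaces.Torus.kernel (ε n)) p.2) *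
          (∫ y, θ p.1 y * (-⟪u p.1 y, FunctionSpaces.Torus.gradient (FunctionSpaces.Torus.kernel (ε n)) (p.2 - y)⟫_ℝ +
            0 * FunctionSpaces.Torus.laplacian (FunctionSpaces.Torus.kernel (ε n)) (p.2 - y))) * ψ p.1 p.2)
        ((volume.restrict (Ioo 0 T)).prod volume) := fun n =>
      (h.integrable_renorm_flux_test (hkS n) hβ1 hβK hψ).congr (Eventually.of_forall fun p => by
        simp only [hconv])
    ------------------------------------------------------------------
    -- (a) the identity at level `n`
    ------------------------------------------------------------------
    have hId : ∀ n,
        (∫ s in Ioo 0 T, ∫ x, β ((θ s ⋆ FunctionSpaces.Torus.kernel (ε n)) x) *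
            (FunctionSpaces.Torus.timeDeriv ψ s x + ⟪u s x, FunctionSpaces.Torus.gradient (ψ s) x⟫_ℝ)) +
          ∫ x, β ((θ₀ ⋆ FunctionSpaces.Torus.kernel (ε n)) x) * ψ 0 x =
        -(∫ s in Ioo 0 T, ∫ x, deriv β ((θ s ⋆ FunctionSpaces.Torus.kernel (ε n)) x) *
            (∫ y, θ s y * ⟪u s x - u s y, FunctionSpaces.Torus.gradient (FunctionSpaces.Torus.kernel (ε n)) (x - y)⟫_ℝ) *
            ψ s x) := by
      intro n
      have h2 := renorm_mollified_test_identity h hT hθ₀i (hkS n) hβ1 hβK hψ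
      simp only [hconv] at h2
      have hslice : ∀ᵐ s ∂(volume.restrict (Ioo 0 T)),
          ∫ x, deriv β ((θ s ⋆ FunctionSpaces.Torus.kernel (ε n)) x) *
              (∫ y, θ s y * (-⟪u s y, FunctionSpaces.Torus.gradient (FunctionSpaces.Torus.kernel (ε n)) (x - y)⟫_ℝ +
                0 * FunctionSpaces.Torus.laplacian (FunctionSpaces.Torus.kernel (ε n)) (x - y))) * ψ s x =
            (∫ x, deriv β ((θ s ⋆ FunctionSpaces.Torus.kernel (ε n)) x) *
                (∫ y, θ s y * ⟪u s x - u s y, FunctionSpaces.Torus.gradient (FunctionSpaces.Torus.kernel (ε n)) (x - y)⟫_ℝ) *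
                ψ s x) +
              ∫ x, β ((θ s ⋆ FunctionSpaces.Torus.kernel (ε n)) x) * ⟪u s x, FunctionSpaces.Torus.gradient (ψ s) x⟫_ℝ := by
        filter_upwards [h.ae_slice_integrable₁, h.ae_integrable_velocity, h.ae_isWeaklyDivFree] with s hs hu hdiv
        exact integral_deriv_comp_mul_flux_mul_test hβ hs.1 hu hs.2.2 hdiv (hkS n) (hψ.isSmooth_slice s)
      have iI : Integrable (fun s => ∫ x, deriv β ((θ s ⋆ FunctionSpaces.Torus.kernel (ε n)) x) *
          (∫ y, θ s y * (-⟪u s y, FunctionSpaces.Torus.gradient (FunctionSpaces.Torus.kernel (ε n)) (x - y)⟫_ℝ +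
            0 * FunctionSpaces.Torus.laplacian (FunctionSpaces.Torus.kernel (ε n)) (x - y))) * ψ s x) (volume.restrict (Ioo 0 T)) :=
        (hI n).integral_prod_left
      have iY : Integrable (fun s => ∫ x, β ((θ s ⋆ FunctionSpaces.Torus.kernel (ε n)) x) *
          ⟪u s x, FunctionSpaces.Torus.gradient (ψ s) x⟫_ℝ) (volume.restrict (Ioo 0 T)) := (hJg n).integral_prod_left
      have iγ : Integrable (fun s => ∫ x, β ((θ s ⋆ FunctionSpaces.Torus.kernel (ε n)) x) *
          FunctionSpaces.Torus.timeDeriv ψ s x) (volume.restrict (Ioo 0 T)) := (hJγ n).integral_prod_left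
      have iX : Integrable (fun s => ∫ x, deriv β ((θ s ⋆ FunctionSpaces.Torus.kernel (ε n)) x) *
          (∫ y, θ s y * ⟪u s x - u s y, FunctionSpaces.Torus.gradient (FunctionSpaces.Torus.kernel (ε n)) (x - y)⟫_ℝ) *
          ψ s x) (volume.restrict (Ioo 0 T)) := by
        refine (iI.sub iY).congr ?_
        filter_upwards [hslice] with s hs
        simp only [Pi.sub_apply]
        rw [hs]
        ring
      have eI : ∫ s in Ioo 0 T, ∫ x, deriv β ((θ s ⋆ FunctionSpaces.Torus.kernel (ε n)) x) *
            (∫ y, θ s y * (-⟪u s y, FunctionSpaces.Torus.gradient (FunctionSpaces.Torus.kernel (ε n)) (x - y)⟫_ℝ +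
              0 * FunctionSpaces.Torus.laplacian (FunctionSpaces.Torus.kernel (ε n)) (x - y))) * ψ s x =
          (∫ s in Ioo 0 T, ∫ x, deriv β ((θ s ⋆ FunctionSpaces.Torus.kernel (ε n)) x) *
              (∫ y, θ s y * ⟪u s x - u s y, FunctionSpaces.Torus.gradient (FunctionSpaces.Torus.kernel (ε n)) (x - y)⟫_ℝ) *
              ψ s x) +
            ∫ s in Ioo 0 T, ∫ x, β ((θ s ⋆ FunctionSpaces.Torus.kernel (ε n)) x) *
              ⟪u s x, FunctionSpaces.Torus.gradient (ψ s) x⟫_ℝ := by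
        rw [← integral_add iX iY]
        exact integral_congr_ae hslice
      have eA : ∫ s in Ioo 0 T, ∫ x, β ((θ s ⋆ FunctionSpaces.Torus.kernel (ε n)) x) *
            (FunctionSpaces.Torus.timeDeriv ψ s x + ⟪u s x, FunctionSpaces.Torus.gradient (ψ s) x⟫_ℝ) =
          (∫ s in Ioo 0 T, ∫ x, β ((θ s ⋆ FunctionSpaces.Torus.kernel (ε n)) x) * FunctionSpaces.Torus.timeDeriv ψ s x) +
            ∫ s in Ioo 0 T, ∫ x, β ((θ s ⋆ FunctionSpaces.Torus.kernel (ε n)) x) *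
              ⟪u s x, FunctionSpaces.Torus.gradient (ψ s) x⟫_ℝ := by
        rw [← integral_add iγ iY]
        refine integral_congr_ae ?_
        filter_upwards [(hJγ n).prod_right_ae, (hJg n).prod_right_ae] with s h1 h2
        rw [← integral_add h1 h2]
        refine integral_congr_ae (Eventually.of_forall fun x => ?_)
        ring
      linarith [h2, eI, eA]
    ------------------------------------------------------------------
    -- (b) the datum pairing converges
    ------------------------------------------------------------------
    have hb : Tendsto (fun n => ∫ x, β ((θ₀ ⋆ FunctionSpaces.Torus.kernel (ε n)) x) * ψ 0 x) atTop
        (𝓝 (∫ x, β (θ₀ x) * ψ 0 x)) := by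
      have hψ0c : Continuous (ψ 0) := (hψ.isSmooth_slice 0).continuous
      obtain ⟨C0, hC0⟩ := FunctionSpaces.Torus.exists_forall_norm_le_of_continuous hψ0c
      have hψ0L2 : eLpNorm (ψ 0) 2 volume < ⊤ := (memLp_two_of_continuous hψ0c).eLpNorm_lt_top
      have hD : Tendsto (fun n => eLpNorm (θ₀ ⋆ FunctionSpaces.Torus.kernel (ε n) - θ₀) 2 volume) atTop (𝓝 0) :=
        FunctionSpaces.Torus.tendsto_eLpNorm_convolution_sub_self hθ₀
          (fun n y => FunctionSpaces.Torus.kernel_nonneg (hε n).le y)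
          (fun n => FunctionSpaces.Torus.integral_kernel (hε n) (hε' n))
          (fun n => FunctionSpaces.Torus.support_kernel_subset (hε n))
          (fun n => FunctionSpaces.Torus.continuous_kernel (hε n) (hε' n)) hε0
      have i0 : Integrable (fun x => β (θ₀ x) * ψ 0 x) volume := by
        refine Integrable.mono' (((integrable_const ‖β 0‖).add (hθ₀i.norm.const_mul (K : ℝ))).mul_const C0)
          ((hβc.comp_aestronglyMeasurable hθ₀.1).mul hψ0c.aestronglyMeasurable) (Eventually.of_forall fun x => ?_)
        rw [norm_mul]
        have h1 := norm_apply_le_of_lipschitz hβK (θ₀ x)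
        have h0 : 0 ≤ ‖β 0‖ + K * ‖θ₀ x‖ := by positivity
        calc ‖β (θ₀ x)‖ * ‖ψ 0 x‖ ≤ (‖β 0‖ + K * ‖θ₀ x‖) * C0 := mul_le_mul h1 (hC0 x) (norm_nonneg _) h0
          _ = _ := by simp
      have iN : ∀ n, Integrable (fun x => β ((θ₀ ⋆ FunctionSpaces.Torus.kernel (ε n)) x) * ψ 0 x) volume := fun n =>
        ((hβc.comp (FunctionSpaces.Torus.continuous_convolution hθ₀i (hkc n))).mul hψ0c).integrable_unitAddTorus
      rw [tendsto_iff_norm_sub_tendsto_zero]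
      have hle : ∀ n, ‖(∫ x, β ((θ₀ ⋆ FunctionSpaces.Torus.kernel (ε n)) x) * ψ 0 x) - ∫ x, β (θ₀ x) * ψ 0 x‖ ≤
          ((K : ℝ≥0∞) * eLpNorm (θ₀ ⋆ FunctionSpaces.Torus.kernel (ε n) - θ₀) 2 volume * eLpNorm (ψ 0) 2 volume).toReal := by
        intro n
        rw [← integral_sub (iN n) i0]
        have e1 : (fun x => β ((θ₀ ⋆ FunctionSpaces.Torus.kernel (ε n)) x) * ψ 0 x - β (θ₀ x) * ψ 0 x) =
            fun x => (β ((θ₀ ⋆ FunctionSpaces.Torus.kernel (ε n)) x) - β (θ₀ x)) * ψ 0 x := by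
          funext x
          ring
        rw [e1, ← toReal_enorm]
        have hAfin : eLpNorm (θ₀ ⋆ FunctionSpaces.Torus.kernel (ε n) - θ₀) 2 volume < ⊤ :=
          ((memLp_two_of_continuous (FunctionSpaces.Torus.continuous_convolution hθ₀i (hkc n))).sub hθ₀).eLpNorm_lt_top
        exact ENNReal.toReal_mono (ENNReal.mul_ne_top (ENNReal.mul_ne_top ENNReal.coe_ne_top hAfin.ne) hψ0L2.ne)
          (enorm_integral_comp_sub_comp_mul_le
            (FunctionSpaces.Torus.continuous_convolution hθ₀i (hkc n)).aestronglyMeasurable hθ₀.1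
            hψ0c.aestronglyMeasurable hβc hβK)
      refine squeeze_zero (fun n => norm_nonneg _) hle ?_
      have h1 : Tendsto (fun n => (K : ℝ≥0∞) * eLpNorm (θ₀ ⋆ FunctionSpaces.Torus.kernel (ε n) - θ₀) 2 volume *
          eLpNorm (ψ 0) 2 volume) atTop (𝓝 0) := by
        have := ENNReal.Tendsto.mul_const (ENNReal.Tendsto.const_mul (a := (K : ℝ≥0∞)) hD
          (Or.inr ENNReal.coe_ne_top)) (Or.inr hψ0L2.ne)
        simpa using this
      have := (ENNReal.tendsto_toReal ENNReal.zero_ne_top).comp h1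
      simpa [Function.comp_def] using this
    ------------------------------------------------------------------
    -- (c) the space–time pairing converges
    ------------------------------------------------------------------
    have hgood : ∀ᵐ s ∂(volume.restrict (Ioo 0 T)), Integrable (θ s) volume ∧ MemLp (θ s) 2 volume ∧ eLpNorm (θ s) 2 volume ≤ C₁ ∧
        AEStronglyMeasurable (u s) volume ∧ s ∈ Ioo 0 T := by
      filter_upwards [h.ae_memLp_two, hC₁, h.ae_aestronglyMeasurable_velocity_slice, hsT] with s h1 h2 h3 h4
      exact ⟨h1.integrable one_le_two, h1, h2, h3, h4⟩
    have hum : AEMeasurable (fun s => (∫⁻ x, ‖u s x‖ₑ ^ 2) ^ (1 / 2 : ℝ)) (volume.restrict (Ioo 0 T)) :=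
      ((hmu.enorm.pow_const 2).lintegral_prod_right').pow_const _
    have ha : Tendsto (fun n => ∫ s in Ioo 0 T, ∫ x, β ((θ s ⋆ FunctionSpaces.Torus.kernel (ε n)) x) *
          (FunctionSpaces.Torus.timeDeriv ψ s x + ⟪u s x, FunctionSpaces.Torus.gradient (ψ s) x⟫_ℝ)) atTop
        (𝓝 (∫ s in Ioo 0 T, ∫ x, β (θ s x) *
          (FunctionSpaces.Torus.timeDeriv ψ s x + ⟪u s x, FunctionSpaces.Torus.gradient (ψ s) x⟫_ℝ))) := by
      -- slice quantities `e n s = ‖θ(s) ⋆ kₙ - θ(s)‖₂`, `w s = ‖∂ₜψ(s) + u(s)·∇ψ(s)‖₂`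
      set e : ℕ → ℝ → ℝ≥0∞ := fun n s => eLpNorm (θ s ⋆ FunctionSpaces.Torus.kernel (ε n) - θ s) 2 volume with he_def
      set w : ℝ → ℝ≥0∞ := fun s => eLpNorm (fun x => FunctionSpaces.Torus.timeDeriv ψ s x +
        ⟪u s x, FunctionSpaces.Torus.gradient (ψ s) x⟫_ℝ) 2 volume with hw_def
      have hem : ∀ n, AEMeasurable (e n) (volume.restrict (Ioo 0 T)) := fun n => h.aemeasurable_eLpNorm_conv_sub (hkc n)
      have hwm : AEMeasurable w (volume.restrict (Ioo 0 T)) := aemeasurable_eLpNorm_two_of_uncurry (hγm.add hgm)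
      have hele : ∀ n, ∀ᵐ s ∂(volume.restrict (Ioo 0 T)), e n s ≤ 2 * C₁ := by
        intro n
        filter_upwards [hgood] with s hs
        have hAm : AEStronglyMeasurable (θ s ⋆ FunctionSpaces.Torus.kernel (ε n)) volume :=
          (FunctionSpaces.Torus.continuous_convolution hs.1 (hkc n)).aestronglyMeasurable
        calc e n s ≤ eLpNorm (θ s ⋆ FunctionSpaces.Torus.kernel (ε n)) 2 volume + eLpNorm (θ s) 2 volume :=
              eLpNorm_sub_le hAm hs.2.1.1 one_le_two
          _ ≤ (∫⁻ y, ‖FunctionSpaces.Torus.kernel (ε n) y‖ₑ) * eLpNorm (θ s) 2 volume + eLpNorm (θ s) 2 volume := by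
              gcongr
              exact FunctionSpaces.Torus.eLpNorm_convolution_le hs.1.aestronglyMeasurable
                (hkc n).aestronglyMeasurable one_le_two
          _ ≤ 2 * C₁ := by
              rw [hk1 n, one_mul, two_mul]
              exact add_le_add hs.2.2.1 hs.2.2.1
      have he0 : ∀ᵐ s ∂(volume.restrict (Ioo 0 T)), Tendsto (fun n => e n s) atTop (𝓝 0) := by
        filter_upwards [h.ae_memLp_two] with s hs
        exact FunctionSpaces.Torus.tendsto_eLpNorm_convolution_sub_self hs
          (fun n y => FunctionSpaces.Torus.kernel_nonneg (hε n).le y)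
          (fun n => FunctionSpaces.Torus.integral_kernel (hε n) (hε' n))
          (fun n => FunctionSpaces.Torus.support_kernel_subset (hε n))
          (fun n => FunctionSpaces.Torus.continuous_kernel (hε n) (hε' n)) hε0
      -- `w s ≤ Cγ + Cg ‖u(s)‖₂`
      have hwle : ∀ᵐ s ∂(volume.restrict (Ioo 0 T)), w s ≤ ENNReal.ofReal Cγ + ENNReal.ofReal Cg * (∫⁻ x, ‖u s x‖ₑ ^ 2) ^ (1 / 2 : ℝ) := by
        filter_upwards [hgood] with s hs
        have hsI := Ioo_subset_Icc_self hs.2.2.2.2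
        have m1 : AEStronglyMeasurable (fun x => FunctionSpaces.Torus.timeDeriv ψ s x) volume :=
          (hψ.timeDeriv.isSmooth_slice s).continuous.aestronglyMeasurable
        have m2 : AEStronglyMeasurable (fun x => ⟪u s x, FunctionSpaces.Torus.gradient (ψ s) x⟫_ℝ) volume :=
          hs.2.2.2.1.inner (hψ.isSmooth_slice s).gradient.continuous.aestronglyMeasurable
        calc w s ≤ eLpNorm (fun x => FunctionSpaces.Torus.timeDeriv ψ s x) 2 volume +
              eLpNorm (fun x => ⟪u s x, FunctionSpaces.Torus.gradient (ψ s) x⟫_ℝ) 2 volume :=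
              eLpNorm_add_le m1 m2 one_le_two
          _ ≤ ENNReal.ofReal Cγ + ENNReal.ofReal Cg * (∫⁻ x, ‖u s x‖ₑ ^ 2) ^ (1 / 2 : ℝ) := by
              refine add_le_add ?_ ?_
              · refine (eLpNorm_le_of_ae_bound (C := Cγ) (Eventually.of_forall fun x => hCγ s hsI x)).trans ?_
                simp
              · have h1 : eLpNorm (fun x => ⟪u s x, FunctionSpaces.Torus.gradient (ψ s) x⟫_ℝ) 2 volume ≤
                    ENNReal.ofReal Cg * eLpNorm (u s) 2 volume :=
                  eLpNorm_le_mul_eLpNorm_of_ae_le_mul (Eventually.of_forall fun x =>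
                    (norm_inner_le_norm _ _).trans (by
                      rw [mul_comm]
                      exact mul_le_mul_of_nonneg_right (hCg s hsI x) (norm_nonneg _))) 2
                rw [eLpNorm_two_eq_lintegral_rpow_half (u s)] at h1
                exact h1
      have hwfin : ∫⁻ s in Ioo 0 T, w s ≠ ⊤ := by
        refine ne_top_of_le_ne_top ?_ (lintegral_mono_ae hwle)
        rw [lintegral_add_left' aemeasurable_const, lintegral_const_mul'' _ hum, lintegral_const]
        exact ENNReal.add_ne_top.2 ⟨ENNReal.mul_ne_top ENNReal.ofReal_ne_top (measure_ne_top _ _),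
          ENNReal.mul_ne_top ENNReal.ofReal_ne_top h.lintegral_velocity_lt_top.ne⟩
      have hwlt : ∀ᵐ s ∂(volume.restrict (Ioo 0 T)), w s < ⊤ := by
        filter_upwards [hwle, ae_lt_top' hum h.lintegral_velocity_lt_top.ne] with s h1 h2
        exact lt_of_le_of_lt h1 (ENNReal.add_lt_top.2 ⟨ENNReal.ofReal_lt_top, ENNReal.mul_lt_top ENNReal.ofReal_lt_top h2⟩)
      -- dominated convergence for `F n s = K e n s w s`
      set F : ℕ → ℝ → ℝ≥0∞ := fun n s => (K : ℝ≥0∞) * e n s * w s with hF_def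
      have hFm : ∀ n, AEMeasurable (F n) (volume.restrict (Ioo 0 T)) := fun n => ((hem n).const_mul _).mul hwm
      have hFle : ∀ n, ∀ᵐ s ∂(volume.restrict (Ioo 0 T)), F n s ≤ (K : ℝ≥0∞) * (2 * C₁) * w s := fun n =>
        (hele n).mono fun s hs => by
          simp only [hF_def]
          gcongr
      have hbfin : ∫⁻ s in Ioo 0 T, (K : ℝ≥0∞) * (2 * C₁) * w s ≠ ⊤ := by
        rw [lintegral_const_mul'' _ hwm]
        exact ENNReal.mul_ne_top (ENNReal.mul_ne_top ENNReal.coe_ne_top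
          (ENNReal.mul_ne_top ENNReal.ofNat_ne_top ENNReal.coe_ne_top)) hwfin
      have hF0 : ∀ᵐ s ∂(volume.restrict (Ioo 0 T)), Tendsto (fun n => F n s) atTop (𝓝 0) := by
        filter_upwards [he0, hwlt] with s hs hw
        have := ENNReal.Tendsto.mul_const (ENNReal.Tendsto.const_mul (a := (K : ℝ≥0∞)) hs
          (Or.inr ENNReal.coe_ne_top)) (Or.inr hw.ne)
        simpa [hF_def] using this
      have hFlim : Tendsto (fun n => ∫⁻ s in Ioo 0 T, F n s) atTop (𝓝 0) := by
        have := tendsto_lintegral_of_dominated_convergence' (fun s => (K : ℝ≥0∞) * (2 * C₁) * w s) hFm hFle hbfin hF0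
        simpa using this
      -- the difference of the pairings is bounded by `∫⁻ F n`
      have hdiff : ∀ n, ‖(∫ s in Ioo 0 T, ∫ x, β ((θ s ⋆ FunctionSpaces.Torus.kernel (ε n)) x) *
            (FunctionSpaces.Torus.timeDeriv ψ s x + ⟪u s x, FunctionSpaces.Torus.gradient (ψ s) x⟫_ℝ)) -
          ∫ s in Ioo 0 T, ∫ x, β (θ s x) *
            (FunctionSpaces.Torus.timeDeriv ψ s x + ⟪u s x, FunctionSpaces.Torus.gradient (ψ s) x⟫_ℝ)‖ ≤
          (∫⁻ s in Ioo 0 T, F n s).toReal := by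
        intro n
        have i1 : Integrable (fun s => ∫ x, β ((θ s ⋆ FunctionSpaces.Torus.kernel (ε n)) x) *
            (FunctionSpaces.Torus.timeDeriv ψ s x + ⟪u s x, FunctionSpaces.Torus.gradient (ψ s) x⟫_ℝ)) (volume.restrict (Ioo 0 T)) :=
          (hJ n).integral_prod_left
        have i2 : Integrable (fun s => ∫ x, β (θ s x) *
            (FunctionSpaces.Torus.timeDeriv ψ s x + ⟪u s x, FunctionSpaces.Torus.gradient (ψ s) x⟫_ℝ)) (volume.restrict (Ioo 0 T)) :=
          hF.integral_prod_left
        rw [← integral_sub i1 i2]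
        have hD : ∀ᵐ s ∂(volume.restrict (Ioo 0 T)), ‖(∫ x, β ((θ s ⋆ FunctionSpaces.Torus.kernel (ε n)) x) *
              (FunctionSpaces.Torus.timeDeriv ψ s x + ⟪u s x, FunctionSpaces.Torus.gradient (ψ s) x⟫_ℝ)) -
            ∫ x, β (θ s x) *
              (FunctionSpaces.Torus.timeDeriv ψ s x + ⟪u s x, FunctionSpaces.Torus.gradient (ψ s) x⟫_ℝ)‖ₑ ≤ F n s := by
          have h1' : ∀ᵐ s ∂(volume.restrict (Ioo 0 T)), Integrable (fun x => β ((θ s ⋆ FunctionSpaces.Torus.kernel (ε n)) x) *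
              (FunctionSpaces.Torus.timeDeriv ψ s x + ⟪u s x, FunctionSpaces.Torus.gradient (ψ s) x⟫_ℝ)) volume :=
            (hJ n).prod_right_ae
          have h2' : ∀ᵐ s ∂(volume.restrict (Ioo 0 T)), Integrable (fun x => β (θ s x) *
              (FunctionSpaces.Torus.timeDeriv ψ s x + ⟪u s x, FunctionSpaces.Torus.gradient (ψ s) x⟫_ℝ)) volume :=
            hF.prod_right_ae
          filter_upwards [h1', h2', hgood] with s h1 h2 hs
          rw [← integral_sub h1 h2]
          have m1 : AEStronglyMeasurable (fun x => FunctionSpaces.Torus.timeDeriv ψ s x) volume :=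
            (hψ.timeDeriv.isSmooth_slice s).continuous.aestronglyMeasurable
          have m2 : AEStronglyMeasurable (fun x => ⟪u s x, FunctionSpaces.Torus.gradient (ψ s) x⟫_ℝ) volume :=
            hs.2.2.2.1.inner (hψ.isSmooth_slice s).gradient.continuous.aestronglyMeasurable
          have e1 : (fun x => β ((θ s ⋆ FunctionSpaces.Torus.kernel (ε n)) x) *
                (FunctionSpaces.Torus.timeDeriv ψ s x + ⟪u s x, FunctionSpaces.Torus.gradient (ψ s) x⟫_ℝ) -
              β (θ s x) * (FunctionSpaces.Torus.timeDeriv ψ s x + ⟪u s x, FunctionSpaces.Torus.gradient (ψ s) x⟫_ℝ)) =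
              fun x => (β ((θ s ⋆ FunctionSpaces.Torus.kernel (ε n)) x) - β (θ s x)) *
                (FunctionSpaces.Torus.timeDeriv ψ s x + ⟪u s x, FunctionSpaces.Torus.gradient (ψ s) x⟫_ℝ) := by
            funext x
            ring
          rw [e1]
          exact enorm_integral_comp_sub_comp_mul_le
            (FunctionSpaces.Torus.continuous_convolution hs.1 (hkc n)).aestronglyMeasurable hs.2.1.1 (m1.add m2) hβc hβK
        have hfin : ∫⁻ s in Ioo 0 T, F n s ≠ ⊤ := ne_top_of_le_ne_top hbfin (lintegral_mono_ae (hFle n))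
        rw [← toReal_enorm]
        exact ENNReal.toReal_mono hfin ((enorm_integral_le_lintegral_enorm _).trans (lintegral_mono_ae hD))
      rw [tendsto_iff_norm_sub_tendsto_zero]
      refine squeeze_zero (fun n => norm_nonneg _) hdiff ?_
      have := (ENNReal.tendsto_toReal ENNReal.zero_ne_top).comp hFlim
      simpa [Function.comp_def] using this
    ------------------------------------------------------------------
    -- (d) the commutator term tends to zero
    ------------------------------------------------------------------
    have hc : Tendsto (fun n => ∫ s in Ioo 0 T, ∫ x, deriv β ((θ s ⋆ FunctionSpaces.Torus.kernel (ε n)) x) *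
          (∫ y, θ s y * ⟪u s x - u s y, FunctionSpaces.Torus.gradient (FunctionSpaces.Torus.kernel (ε n)) (x - y)⟫_ℝ) *
          ψ s x) atTop (𝓝 0) := by
      set R : ℕ → ℝ → ℝ≥0∞ := fun n s => eLpNorm (fun x => ∫ y, θ s y *
        ⟪u s x - u s y, FunctionSpaces.Torus.gradient (FunctionSpaces.Torus.kernel (ε n)) (x - y)⟫_ℝ) 2 volume with hR_def
      have hRm : ∀ n, AEMeasurable (R n) (volume.restrict (Ioo 0 T)) := fun n =>
        aemeasurable_eLpNorm_two_of_uncurry (h.aestronglyMeasurable_uncurry_commutator (hkS n))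
      have hrm : ∀ᵐ s ∂(volume.restrict (Ioo 0 T)), ∀ n, AEStronglyMeasurable (fun x => ∫ y, θ s y *
          ⟪u s x - u s y, FunctionSpaces.Torus.gradient (FunctionSpaces.Torus.kernel (ε n)) (x - y)⟫_ℝ) volume :=
        ae_all_iff.2 fun n => (h.aestronglyMeasurable_uncurry_commutator (hkS n)).prodMk_left
      set M : ℝ≥0∞ := ENNReal.ofReal (FunctionSpaces.Torus.gradProfileMass d) * C₁ with hM_def
      have hMt : M ≠ ⊤ := ENNReal.mul_ne_top ENNReal.ofReal_ne_top ENNReal.coe_ne_top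
      have hRle : ∀ n, ∀ᵐ s ∂(volume.restrict (Ioo 0 T)), R n s ≤ M * (L s : ℝ≥0∞) := by
        intro n
        filter_upwards [hgood, hlip] with s hs hl
        calc R n s ≤ ENNReal.ofReal (L s * FunctionSpaces.Torus.gradProfileMass d) * eLpNorm (θ s) 2 volume :=
              eLpNorm_comm_le hl hs.1 (hε n) (hε' n)
          _ ≤ ENNReal.ofReal (L s * FunctionSpaces.Torus.gradProfileMass d) * C₁ := by
              gcongr
              exact hs.2.2.1
          _ = M * (L s : ℝ≥0∞) := by
              rw [hM_def, ENNReal.ofReal_mul (L s).coe_nonneg, ENNReal.ofReal_coe_nnreal]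
              ring
      have hR0 : ∀ᵐ s ∂(volume.restrict (Ioo 0 T)), Tendsto (fun n => R n s) atTop (𝓝 0) := by
        filter_upwards [h.ae_memLp_two, hlip, h.ae_isWeaklyDivFree] with s hm hl hd
        exact tendsto_eLpNorm_comm hl hd hm hε hε' hε0
      set F : ℕ → ℝ → ℝ≥0∞ := fun n s => ((K : ℝ≥0∞) * ENNReal.ofReal Cψ) * R n s with hF_def
      have hKC : (K : ℝ≥0∞) * ENNReal.ofReal Cψ ≠ ⊤ := ENNReal.mul_ne_top ENNReal.coe_ne_top ENNReal.ofReal_ne_top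
      have hFm : ∀ n, AEMeasurable (F n) (volume.restrict (Ioo 0 T)) := fun n => (hRm n).const_mul _
      have hFle : ∀ n, ∀ᵐ s ∂(volume.restrict (Ioo 0 T)), F n s ≤ ((K : ℝ≥0∞) * ENNReal.ofReal Cψ * M) * (L s : ℝ≥0∞) := fun n =>
        (hRle n).mono fun s hs => by
          simp only [hF_def]
          rw [mul_assoc ((K : ℝ≥0∞) * ENNReal.ofReal Cψ) M]
          gcongr
      have hbfin : ∫⁻ s in Ioo 0 T, ((K : ℝ≥0∞) * ENNReal.ofReal Cψ * M) * (L s : ℝ≥0∞) ≠ ⊤ := by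
        rw [lintegral_const_mul' _ _ (ENNReal.mul_ne_top hKC hMt)]
        exact ENNReal.mul_ne_top (ENNReal.mul_ne_top hKC hMt) hL.ne
      have hF0 : ∀ᵐ s ∂(volume.restrict (Ioo 0 T)), Tendsto (fun n => F n s) atTop (𝓝 0) := by
        filter_upwards [hR0] with s hs
        have := ENNReal.Tendsto.const_mul hs (Or.inr hKC)
        simpa [hF_def] using this
      have hFlim : Tendsto (fun n => ∫⁻ s in Ioo 0 T, F n s) atTop (𝓝 0) := by
        have := tendsto_lintegral_of_dominated_convergence' (fun s => ((K : ℝ≥0∞) * ENNReal.ofReal Cψ * M) * (L s : ℝ≥0∞))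
          hFm hFle hbfin hF0
        simpa using this
      have hXle : ∀ n, ‖∫ s in Ioo 0 T, ∫ x, deriv β ((θ s ⋆ FunctionSpaces.Torus.kernel (ε n)) x) *
          (∫ y, θ s y * ⟪u s x - u s y, FunctionSpaces.Torus.gradient (FunctionSpaces.Torus.kernel (ε n)) (x - y)⟫_ℝ) *
          ψ s x‖ ≤ (∫⁻ s in Ioo 0 T, F n s).toReal := by
        intro n
        have hD : ∀ᵐ s ∂(volume.restrict (Ioo 0 T)), ‖∫ x, deriv β ((θ s ⋆ FunctionSpaces.Torus.kernel (ε n)) x) *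
            (∫ y, θ s y * ⟪u s x - u s y, FunctionSpaces.Torus.gradient (FunctionSpaces.Torus.kernel (ε n)) (x - y)⟫_ℝ) *
            ψ s x‖ₑ ≤ F n s := by
          filter_upwards [hrm, hgood] with s hr hs
          have hsI := Ioo_subset_Icc_self hs.2.2.2.2
          refine (enorm_integral_le_lintegral_enorm _).trans ?_
          calc ∫⁻ x, ‖deriv β ((θ s ⋆ FunctionSpaces.Torus.kernel (ε n)) x) *
                (∫ y, θ s y * ⟪u s x - u s y, FunctionSpaces.Torus.gradient (FunctionSpaces.Torus.kernel (ε n)) (x - y)⟫_ℝ) *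
                ψ s x‖ₑ
              ≤ ∫⁻ x, ((K : ℝ≥0∞) * ENNReal.ofReal Cψ) * ‖∫ y, θ s y *
                  ⟪u s x - u s y, FunctionSpaces.Torus.gradient (FunctionSpaces.Torus.kernel (ε n)) (x - y)⟫_ℝ‖ₑ := by
                refine lintegral_mono fun x => ?_
                rw [enorm_mul, enorm_mul]
                have h3 : ‖ψ s x‖ₑ ≤ ENNReal.ofReal Cψ := by
                  rw [← ofReal_norm]
                  exact ENNReal.ofReal_le_ofReal (hCψ s hsI x)
                calc ‖deriv β ((θ s ⋆ FunctionSpaces.Torus.kernel (ε n)) x)‖ₑ *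
                      ‖∫ y, θ s y * ⟪u s x - u s y, FunctionSpaces.Torus.gradient (FunctionSpaces.Torus.kernel (ε n)) (x - y)⟫_ℝ‖ₑ *
                      ‖ψ s x‖ₑ
                    ≤ (K : ℝ≥0∞) *
                      ‖∫ y, θ s y * ⟪u s x - u s y, FunctionSpaces.Torus.gradient (FunctionSpaces.Torus.kernel (ε n)) (x - y)⟫_ℝ‖ₑ *
                      ENNReal.ofReal Cψ := by
                      gcongr
                      exact hβ'K _
                  _ = _ := by ring
            _ = ((K : ℝ≥0∞) * ENNReal.ofReal Cψ) * ∫⁻ x, ‖∫ y, θ s y *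
                  ⟪u s x - u s y, FunctionSpaces.Torus.gradient (FunctionSpaces.Torus.kernel (ε n)) (x - y)⟫_ℝ‖ₑ := by
                rw [lintegral_const_mul'' _ (hr n).enorm]
            _ ≤ F n s := by
                simp only [hF_def, hR_def]
                gcongr
                rw [← eLpNorm_one_eq_lintegral_enorm]
                exact eLpNorm_le_eLpNorm_of_exponent_le (by norm_num) (hr n)
        have hfin : ∫⁻ s in Ioo 0 T, F n s ≠ ⊤ := ne_top_of_le_ne_top hbfin (lintegral_mono_ae (hFle n))
        rw [← toReal_enorm]
        exact ENNReal.toReal_mono hfin ((enorm_integral_le_lintegral_enorm _).trans (lintegral_mono_ae hD))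
      refine squeeze_zero_norm hXle ?_
      have := (ENNReal.tendsto_toReal ENNReal.zero_ne_top).comp hFlim
      simpa [Function.comp_def] using this
    ------------------------------------------------------------------
    -- (e) conclusion
    ------------------------------------------------------------------
    have hlim1 := (ha.add hb).congr hId
    have hlim2 : Tendsto (fun n => -(∫ s in Ioo 0 T, ∫ x, deriv β ((θ s ⋆ FunctionSpaces.Torus.kernel (ε n)) x) *
          (∫ y, θ s y * ⟪u s x - u s y, FunctionSpaces.Torus.gradient (FunctionSpaces.Torus.kernel (ε n)) (x - y)⟫_ℝ) *
          ψ s x)) atTop (𝓝 0) := by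
      simpa using hc.neg
    exact tendsto_nhds_unique hlim1 hlim2


/-! ## §5 Continuous `β` for bounded solutions (uniform approximation on the essential range) -/

/-- An `L^∞` function is a.e. bounded by a real constant. [folklore] -/
private theorem ae_norm_le_of_memLp_top {f : UnitAddTorus d → ℝ} (hf : MemLp f ∞ volume) :
    ∃ H : ℝ, ∀ᵐ x ∂(volume : Measure (UnitAddTorus d)), ‖f x‖ ≤ H := by
  refine ⟨(eLpNorm f ∞ volume).toReal, ?_⟩
  filter_upwards [ae_le_eLpNormEssSup (μ := (volume : Measure (UnitAddTorus d))) (f := f)] with x hx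
  rw [← eLpNorm_exponent_top] at hx
  rw [← toReal_enorm]
  exact ENNReal.toReal_mono hf.eLpNorm_lt_top.ne hx

/-- From the iterated a.e. bound `|θ(t,x)| ≤ M` (a.e. `t`, a.e. `x`) to the product a.e. bound on
`(0,T) × T^d` (through a measurable modification of the jointly a.e.-measurable `θ`). [folklore] -/
private theorem ae_prod_abs_le_of_ae_ae {κ : ℝ} (h : IsWeakScalarTransportOn T κ u θ₀ θ) {M : ℝ}
    (hb : ∀ᵐ t ∂(volume.restrict (Ioo 0 T)), ∀ᵐ x ∂(volume : Measure (UnitAddTorus d)), |θ t x| ≤ M) :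
    ∀ᵐ p ∂((volume.restrict (Ioo 0 T)).prod (volume : Measure (UnitAddTorus d))), |θ p.1 p.2| ≤ M := by
  have hmu := h.aestronglyMeasurable_uncurry
  set θ' : ℝ × UnitAddTorus d → ℝ := hmu.mk (uncurry θ) with hθ'
  have hθ'm : Measurable θ' := hmu.stronglyMeasurable_mk.measurable
  have hθθ' : uncurry θ =ᵐ[(volume.restrict (Ioo 0 T)).prod volume] θ' := hmu.ae_eq_mk
  have hS : MeasurableSet {p : ℝ × UnitAddTorus d | |θ' p| ≤ M} :=
    measurableSet_le (continuous_abs.measurable.comp hθ'm) measurable_const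
  have h1 : ∀ᵐ t ∂(volume.restrict (Ioo 0 T)), ∀ᵐ x ∂(volume : Measure (UnitAddTorus d)),
      |θ' (t, x)| ≤ M := by
    filter_upwards [hb, Measure.ae_ae_of_ae_prod hθθ'] with t ht ht'
    filter_upwards [ht, ht'] with x hx hx'
    simp only [uncurry] at hx'
    rw [← hx']
    exact hx
  have h2 : ∀ᵐ p ∂((volume.restrict (Ioo 0 T)).prod (volume : Measure (UnitAddTorus d))), |θ' p| ≤ M := by
    rw [Measure.ae_prod_iff_ae_ae hS]
    exact h1
  filter_upwards [h2, hθθ'] with p hp hp'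
  simp only [uncurry] at hp'
  rw [hp']
  exact hp

/-- **Smooth Lipschitz approximation on a compact interval**: for a continuous `β` and every `m` there is
`βₘ ∈ C^∞(ℝ)`, globally Lipschitz, with `|βₘ - β| ≤ 1/(m+1)` on `[-R, R]` (Weierstrass polynomial times a
smooth cut-off). [folklore] -/
private theorem exists_contDiff_lipschitz_near {β : ℝ → ℝ} (hβ : Continuous β) (R : ℝ) (m : ℕ) :
    ∃ βm : ℝ → ℝ, ContDiff ℝ ∞ βm ∧ (∃ K : ℝ≥0, LipschitzWith K βm) ∧
      ∀ z ∈ Icc (-R) R, |βm z - β z| ≤ 1 / ((m : ℝ) + 1) := by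
  obtain ⟨p, hp⟩ := exists_polynomial_near_of_continuousOn (-R) R β hβ.continuousOn (1 / ((m : ℝ) + 1))
    (by positivity)
  have hev : ContDiff ℝ ∞ (fun x : ℝ => p.eval x) := by
    have h := Polynomial.contDiff_aeval (𝕜 := ℝ) p ((⊤ : ℕ∞) : WithTop ℕ∞)
    simpa only [Polynomial.coe_aeval_eq_eval] using h
  let χ : ContDiffBump (0 : ℝ) := ⟨|R| + 1, |R| + 2, by positivity, by linarith⟩
  have hsm : ContDiff ℝ ∞ (fun z => χ z * p.eval z) := χ.contDiff.mul hev
  have hcs : HasCompactSupport (fun z => χ z * p.eval z) := χ.hasCompactSupport.mul_right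
  refine ⟨fun z => χ z * p.eval z, hsm, ContDiff.lipschitzWith_of_hasCompactSupport hcs hsm (by simp), ?_⟩
  intro z hz
  have hzR : ‖z‖ ≤ |R| + 1 := by
    rw [Real.norm_eq_abs]
    have : |z| ≤ |R| := abs_le.2 ⟨by linarith [hz.1, le_abs_self R], by linarith [hz.2, le_abs_self R]⟩
    linarith
  have hχ : χ z = 1 := χ.one_of_mem_closedBall (mem_closedBall_zero_iff.2 hzR)
  beta_reduce
  rw [hχ, one_mul]
  exact (hp z hz).le

/-- **The DiPerna–Lions renormalisation theorem for Lipschitz drifts: bounded solutions, continuous `β`**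
(DiPerna–Lions 1989, §II.3, Thm. II.3 / Cor. II.1 with the remark after Thm. II.3 on general `β` for
bounded solutions; Bagnara–Boutros–De Lellis–Mayboroda 2026, Def. 2.1): for a drift with `u(t)`
`L(t)`-Lipschitz for a.e. `t`, `∫₀ᵀ L < ∞`, a bounded datum `θ₀ ∈ L^∞`, a weak solution `θ` with
`|θ| ≤ M` a.e. on `(0,T) × T^d`, and every continuous `β : ℝ → ℝ` (in particular every `β ∈ C¹`),
`β ∘ θ` is a weak solution with datum `β ∘ θ₀`.  Proof: §4 for the smooth Lipschitz approximants
`βₘ → β` uniform on the essential range `[-R, R]` (`exists_contDiff_lipschitz_near`), and dominated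
convergence in the weak formulation. [cite: DiPernaLions1989, §II.3 Thm. II.3, Cor. II.1] -/
theorem comp_of_lipschitz_of_abs_le (h : IsWeakScalarTransportOn T 0 u θ₀ θ) (hθ₀ : MemLp θ₀ ∞ volume)
    {M : ℝ} (hθb : ∀ᵐ t ∂(volume.restrict (Ioo 0 T)), ∀ᵐ x ∂(volume : Measure (UnitAddTorus d)), |θ t x| ≤ M)
    {β : ℝ → ℝ} (hβ : Continuous β)
    {L : ℝ → ℝ≥0} (hlip : ∀ᵐ t ∂((volume : Measure ℝ).restrict (Ioo 0 T)), LipschitzWith (L t) (u t))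
    (hL : ∫⁻ t in Ioo 0 T, (L t : ℝ≥0∞) < ⊤) :
    IsWeakScalarTransportOn T 0 u (fun x => β (θ₀ x)) (fun t x => β (θ t x)) where
  aestronglyMeasurable := hβ.comp_aestronglyMeasurable h.aestronglyMeasurable
  aestronglyMeasurable_velocity := h.aestronglyMeasurable_velocity
  ae_lintegral_sq_le := by
    obtain ⟨B', hB'⟩ := (isCompact_Icc : IsCompact (Icc (-M) M)).exists_bound_of_continuousOn hβ.continuousOn
    refine ⟨B'.toNNReal ^ 2, ?_⟩
    filter_upwards [hθb] with t ht
    have hle : ∀ᵐ x ∂(volume : Measure (UnitAddTorus d)), ‖β (θ t x)‖ₑ ^ 2 ≤ (B'.toNNReal : ℝ≥0∞) ^ 2 := by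
      filter_upwards [ht] with x hx
      gcongr
      rw [← ofReal_norm]
      exact ENNReal.ofReal_le_ofReal (hB' _ (mem_Icc.2 (abs_le.1 hx)))
    refine (lintegral_mono_ae hle).trans ?_
    rw [lintegral_const, measure_univ, mul_one, ENNReal.coe_pow]
  lintegral_velocity_lt_top := h.lintegral_velocity_lt_top
  lintegral_mul_lt_top := by
    obtain ⟨B', hB'⟩ := (isCompact_Icc : IsCompact (Icc (-M) M)).exists_bound_of_continuousOn hβ.continuousOn
    have hmu := h.aestronglyMeasurable_uncurry_velocity
    have hmθ := h.aestronglyMeasurable_uncurry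
    have hF : AEMeasurable (fun p : ℝ × UnitAddTorus d => ‖u p.1 p.2‖ₑ * ‖β (θ p.1 p.2)‖ₑ)
        ((volume.restrict (Ioo 0 T)).prod volume) :=
      hmu.enorm.mul (hβ.comp_aestronglyMeasurable hmθ).enorm
    have hF₂ : AEMeasurable (fun p : ℝ × UnitAddTorus d => ‖u p.1 p.2‖ₑ) ((volume.restrict (Ioo 0 T)).prod volume) :=
      hmu.enorm
    rw [← lintegral_prod _ hF]
    have hle : ∀ᵐ p ∂((volume.restrict (Ioo 0 T)).prod (volume : Measure (UnitAddTorus d))),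
        ‖u p.1 p.2‖ₑ * ‖β (θ p.1 p.2)‖ₑ ≤ ‖u p.1 p.2‖ₑ * ENNReal.ofReal B' := by
      filter_upwards [h.ae_prod_abs_le_of_ae_ae hθb] with p hp
      gcongr
      rw [← ofReal_norm]
      exact ENNReal.ofReal_le_ofReal (hB' _ (mem_Icc.2 (abs_le.1 hp)))
    refine lt_of_le_of_lt (lintegral_mono_ae hle) ?_
    rw [lintegral_mul_const'' _ hF₂]
    refine ENNReal.mul_lt_top ?_ ENNReal.ofReal_lt_top
    have := h.integrable_uncurry_velocity.2
    rw [hasFiniteIntegral_iff_enorm] at this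
    exact this
  ae_isWeaklyDivFree := h.ae_isWeaklyDivFree
  weak_eq := by
    intro ψ hψ
    simp only [zero_mul, add_zero]
    -- the essential range `[-R, R]`
    obtain ⟨H₀, hH₀⟩ := ae_norm_le_of_memLp_top hθ₀
    set R : ℝ := max H₀ M with hR
    have hθ₀R : ∀ᵐ x ∂(volume : Measure (UnitAddTorus d)), θ₀ x ∈ Icc (-R) R := by
      filter_upwards [hH₀] with x hx
      rw [Real.norm_eq_abs] at hx
      exact mem_Icc.2 (abs_le.1 (hx.trans (le_max_left _ _)))
    have hθR : ∀ᵐ p ∂((volume.restrict (Ioo 0 T)).prod (volume : Measure (UnitAddTorus d))),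
        θ p.1 p.2 ∈ Icc (-R) R := by
      filter_upwards [h.ae_prod_abs_le_of_ae_ae hθb] with p hp
      exact mem_Icc.2 (abs_le.1 (hp.trans (le_max_right _ _)))
    obtain ⟨B, hB⟩ := (isCompact_Icc : IsCompact (Icc (-R) R)).exists_bound_of_continuousOn hβ.continuousOn
    -- smooth Lipschitz approximants
    choose βs hβs hβsK hβsn using fun m : ℕ => exists_contDiff_lipschitz_near hβ R m
    have hβsB : ∀ m, ∀ z ∈ Icc (-R) R, ‖βs m z‖ ≤ B + 1 := fun m z hz => by
      have h1 := hβsn m z hz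
      have h2 := hB z hz
      have h3 : 1 / ((m : ℝ) + 1) ≤ 1 := by
        rw [div_le_one (by positivity)]
        linarith [(Nat.cast_nonneg m : (0 : ℝ) ≤ m)]
      rw [Real.norm_eq_abs] at h2 ⊢
      calc |βs m z| = |β z + (βs m z - β z)| := by ring_nf
        _ ≤ |β z| + |βs m z - β z| := abs_add_le _ _
        _ ≤ B + 1 := add_le_add h2 (h1.trans h3)
    have hβB : ∀ z ∈ Icc (-R) R, ‖β z‖ ≤ B + 1 := fun z hz => (hB z hz).trans (by linarith)
    have hβslim : ∀ z ∈ Icc (-R) R, Tendsto (fun m => βs m z) atTop (𝓝 (β z)) := fun z hz => by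
      rw [tendsto_iff_norm_sub_tendsto_zero]
      refine squeeze_zero (fun m => norm_nonneg _) (fun m => ?_) tendsto_one_div_add_atTop_nhds_zero_nat
      rw [Real.norm_eq_abs]
      exact hβsn m z hz
    -- the weak formulation for each approximant (§4)
    have hWm : ∀ m, (∫ s in Ioo 0 T, ∫ x, βs m (θ s x) *
        (FunctionSpaces.Torus.timeDeriv ψ s x + ⟪u s x, FunctionSpaces.Torus.gradient (ψ s) x⟫_ℝ)) +
          ∫ x, βs m (θ₀ x) * ψ 0 x = 0 := fun m => by
      obtain ⟨K, hK⟩ := hβsK m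
      have := (h.comp_of_lipschitz_of_contDiff (hθ₀.mono_exponent le_top) (hβs m) hK hlip hL).weak_eq ψ hψ
      simpa only [zero_mul, add_zero] using this
    -- the weight `W = ∂ₜψ + u·∇ψ` is integrable on `(0,T) × T^d`
    obtain ⟨Cγ, hCγ⟩ := exists_bound_of_continuous_uncurry hψ.continuous_uncurry_timeDeriv 0 T
    obtain ⟨Cg, hCg⟩ := exists_bound_of_continuous_uncurry hψ.continuous_uncurry_gradient 0 T
    have hpT : ∀ᵐ p : ℝ × UnitAddTorus d ∂((volume.restrict (Ioo 0 T)).prod volume), p.1 ∈ Ioo 0 T :=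
      ae_prod_of_ae_forall (T := T) ((ae_restrict_mem measurableSet_Ioo).mono fun s hs _ => hs)
    have hmθ := h.aestronglyMeasurable_uncurry
    have hmu := h.aestronglyMeasurable_uncurry_velocity
    have hWm' : AEStronglyMeasurable (fun p : ℝ × UnitAddTorus d => FunctionSpaces.Torus.timeDeriv ψ p.1 p.2 +
        ⟪u p.1 p.2, FunctionSpaces.Torus.gradient (ψ p.1) p.2⟫_ℝ) ((volume.restrict (Ioo 0 T)).prod volume) :=
      hψ.continuous_uncurry_timeDeriv.aestronglyMeasurable.add (hmu.inner hψ.continuous_uncurry_gradient.aestronglyMeasurable)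
    have hWi : Integrable (fun p : ℝ × UnitAddTorus d => FunctionSpaces.Torus.timeDeriv ψ p.1 p.2 +
        ⟪u p.1 p.2, FunctionSpaces.Torus.gradient (ψ p.1) p.2⟫_ℝ) ((volume.restrict (Ioo 0 T)).prod volume) := by
      refine Integrable.mono' ((integrable_const Cγ).add (h.integrable_uncurry_velocity.norm.mul_const Cg)) hWm' ?_
      filter_upwards [hpT] with p hp
      exact (norm_add_le _ _).trans (add_le_add (hCγ p.1 (Ioo_subset_Icc_self hp) p.2)
        ((norm_inner_le_norm _ _).trans
          (mul_le_mul_of_nonneg_left (hCg p.1 (Ioo_subset_Icc_self hp) p.2) (norm_nonneg _))))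
    -- dominated convergence on `(0,T) × T^d`
    have hFm : ∀ m, AEStronglyMeasurable (fun p : ℝ × UnitAddTorus d => βs m (θ p.1 p.2) *
        (FunctionSpaces.Torus.timeDeriv ψ p.1 p.2 + ⟪u p.1 p.2, FunctionSpaces.Torus.gradient (ψ p.1) p.2⟫_ℝ))
        ((volume.restrict (Ioo 0 T)).prod volume) := fun m =>
      ((hβs m).continuous.comp_aestronglyMeasurable hmθ).mul hWm'
    have hFlim_m : AEStronglyMeasurable (fun p : ℝ × UnitAddTorus d => β (θ p.1 p.2) *
        (FunctionSpaces.Torus.timeDeriv ψ p.1 p.2 + ⟪u p.1 p.2, FunctionSpaces.Torus.gradient (ψ p.1) p.2⟫_ℝ))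
        ((volume.restrict (Ioo 0 T)).prod volume) :=
      (hβ.comp_aestronglyMeasurable hmθ).mul hWm'
    have hbd : ∀ m, ∀ᵐ p ∂((volume.restrict (Ioo 0 T)).prod (volume : Measure (UnitAddTorus d))),
        ‖βs m (θ p.1 p.2) * (FunctionSpaces.Torus.timeDeriv ψ p.1 p.2 +
          ⟪u p.1 p.2, FunctionSpaces.Torus.gradient (ψ p.1) p.2⟫_ℝ)‖ ≤
          (B + 1) * ‖FunctionSpaces.Torus.timeDeriv ψ p.1 p.2 + ⟪u p.1 p.2, FunctionSpaces.Torus.gradient (ψ p.1) p.2⟫_ℝ‖ :=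
      fun m => by
        filter_upwards [hθR] with p hp
        rw [norm_mul]
        exact mul_le_mul_of_nonneg_right (hβsB m _ hp) (norm_nonneg _)
    have hbd' : ∀ᵐ p ∂((volume.restrict (Ioo 0 T)).prod (volume : Measure (UnitAddTorus d))),
        ‖β (θ p.1 p.2) * (FunctionSpaces.Torus.timeDeriv ψ p.1 p.2 +
          ⟪u p.1 p.2, FunctionSpaces.Torus.gradient (ψ p.1) p.2⟫_ℝ)‖ ≤
          (B + 1) * ‖FunctionSpaces.Torus.timeDeriv ψ p.1 p.2 + ⟪u p.1 p.2, FunctionSpaces.Torus.gradient (ψ p.1) p.2⟫_ℝ‖ := by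
      filter_upwards [hθR] with p hp
      rw [norm_mul]
      exact mul_le_mul_of_nonneg_right (hβB _ hp) (norm_nonneg _)
    have hFi : ∀ m, Integrable (fun p : ℝ × UnitAddTorus d => βs m (θ p.1 p.2) *
        (FunctionSpaces.Torus.timeDeriv ψ p.1 p.2 + ⟪u p.1 p.2, FunctionSpaces.Torus.gradient (ψ p.1) p.2⟫_ℝ))
        ((volume.restrict (Ioo 0 T)).prod volume) := fun m =>
      Integrable.mono' (hWi.norm.const_mul _) (hFm m) (hbd m)
    have hFi' : Integrable (fun p : ℝ × UnitAddTorus d => β (θ p.1 p.2) *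
        (FunctionSpaces.Torus.timeDeriv ψ p.1 p.2 + ⟪u p.1 p.2, FunctionSpaces.Torus.gradient (ψ p.1) p.2⟫_ℝ))
        ((volume.restrict (Ioo 0 T)).prod volume) :=
      Integrable.mono' (hWi.norm.const_mul _) hFlim_m hbd'
    have hDCT : Tendsto (fun m => ∫ p, βs m (θ p.1 p.2) *
        (FunctionSpaces.Torus.timeDeriv ψ p.1 p.2 + ⟪u p.1 p.2, FunctionSpaces.Torus.gradient (ψ p.1) p.2⟫_ℝ)
          ∂((volume.restrict (Ioo 0 T)).prod (volume : Measure (UnitAddTorus d)))) atTop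
        (𝓝 (∫ p, β (θ p.1 p.2) *
          (FunctionSpaces.Torus.timeDeriv ψ p.1 p.2 + ⟪u p.1 p.2, FunctionSpaces.Torus.gradient (ψ p.1) p.2⟫_ℝ)
            ∂((volume.restrict (Ioo 0 T)).prod (volume : Measure (UnitAddTorus d))))) := by
      refine tendsto_integral_of_dominated_convergence _ hFm (hWi.norm.const_mul _) hbd ?_
      filter_upwards [hθR] with p hp
      exact (hβslim _ hp).mul_const _
    have e_m : ∀ m, ∫ p, βs m (θ p.1 p.2) *
        (FunctionSpaces.Torus.timeDeriv ψ p.1 p.2 + ⟪u p.1 p.2, FunctionSpaces.Torus.gradient (ψ p.1) p.2⟫_ℝ)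
          ∂((volume.restrict (Ioo 0 T)).prod (volume : Measure (UnitAddTorus d))) =
        ∫ s in Ioo 0 T, ∫ x, βs m (θ s x) *
          (FunctionSpaces.Torus.timeDeriv ψ s x + ⟪u s x, FunctionSpaces.Torus.gradient (ψ s) x⟫_ℝ) := fun m =>
      integral_prod _ (hFi m)
    have e_lim : ∫ p, β (θ p.1 p.2) *
        (FunctionSpaces.Torus.timeDeriv ψ p.1 p.2 + ⟪u p.1 p.2, FunctionSpaces.Torus.gradient (ψ p.1) p.2⟫_ℝ)
          ∂((volume.restrict (Ioo 0 T)).prod (volume : Measure (UnitAddTorus d))) =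
        ∫ s in Ioo 0 T, ∫ x, β (θ s x) *
          (FunctionSpaces.Torus.timeDeriv ψ s x + ⟪u s x, FunctionSpaces.Torus.gradient (ψ s) x⟫_ℝ) :=
      integral_prod _ hFi'
    have ha : Tendsto (fun m => ∫ s in Ioo 0 T, ∫ x, βs m (θ s x) *
        (FunctionSpaces.Torus.timeDeriv ψ s x + ⟪u s x, FunctionSpaces.Torus.gradient (ψ s) x⟫_ℝ)) atTop
        (𝓝 (∫ s in Ioo 0 T, ∫ x, β (θ s x) *
          (FunctionSpaces.Torus.timeDeriv ψ s x + ⟪u s x, FunctionSpaces.Torus.gradient (ψ s) x⟫_ℝ))) := by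
      rw [← e_lim]
      exact hDCT.congr e_m
    -- the datum pairing
    have hψ0c : Continuous (ψ 0) := (hψ.isSmooth_slice 0).continuous
    have hb : Tendsto (fun m => ∫ x, βs m (θ₀ x) * ψ 0 x) atTop (𝓝 (∫ x, β (θ₀ x) * ψ 0 x)) := by
      refine tendsto_integral_of_dominated_convergence (fun x => (B + 1) * ‖ψ 0 x‖)
        (fun m => ((hβs m).continuous.comp_aestronglyMeasurable hθ₀.1).mul hψ0c.aestronglyMeasurable)
        (hψ0c.integrable_unitAddTorus.norm.const_mul _) (fun m => ?_) ?_
      · filter_upwards [hθ₀R] with x hx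
        rw [norm_mul]
        exact mul_le_mul_of_nonneg_right (hβsB m _ hx) (norm_nonneg _)
      · filter_upwards [hθ₀R] with x hx
        exact (hβslim _ hx).mul_const _
    -- conclusion
    have hlim := ha.add hb
    rw [show (fun m => (∫ s in Ioo 0 T, ∫ x, βs m (θ s x) *
        (FunctionSpaces.Torus.timeDeriv ψ s x + ⟪u s x, FunctionSpaces.Torus.gradient (ψ s) x⟫_ℝ)) +
          ∫ x, βs m (θ₀ x) * ψ 0 x) = fun _ => (0 : ℝ) from funext hWm] at hlim
    exact (tendsto_nhds_unique tendsto_const_nhds hlim).symm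

end IsWeakScalarTransportOn

end Torus

end Literature.Analysis.FluidPDE

end
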